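import Literature.Probability.RandomPlanarGeometry.SAWRatioLimit
import Mathlib.Algebra.Order.Chebyshev
import HarnessLib

/-!
# Kesten's patterns `U`, `V` and Theorem 7.3.2(a) of Madras–Slade from the pattern theorem

Topic `Literature/Probability/RandomPlanarGeometry`, continuing `SAWRatioLimit.lean` (which
reduces Kesten's ratio limit theorem `c_{N+2}/c_N → μ²` = the named fact
`BDGS2012_tendsto_count_ratio_two` of `BDGS2012.lean` to the inequality of Madras–Slade
Theorem 7.3.2(a), `φ_N φ_{N+2} ≥ φ_N² - D/N`, `φ_N = c_{N+2}/c_N`). Here that inequality is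
proved from its one external input, **Kesten's Pattern Theorem 7.2.3(a) for the cube-pattern
`(V, Q)`**, taken in the weak quantitative form which the printed proof uses: for some `a > 0`
and `C`, at most `C c_N / N³` of the `N`-step self-avoiding walks have fewer than `aN`
occurrences of `(V, Q)` (the theorem gives `≤ (μ(1-ε))^N ≤ C c_N/N³`, (7.3.12)). Source:
N. Madras, G. Slade, *The Self-Avoiding Walk* (1993), proof of Theorem 7.3.2, pp. 244–247,
eqs. (7.3.5)–(7.3.12), with Definition 7.2.2 (occurrence of `(P, Q)`) and Figure 7.4.

## Contents (namespace `Literature.Probability.RandomPlanarGeometry.SAW.Zd`; all PROVED)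

Everything is formulated on `ℤ^{d+2}` (`d : ℕ` arbitrary), i.e. in all dimensions `≥ 2`, in the
vertex-function model `saws (d+2) n` of `SAWCount.lean`.
* `mk2 a b = (a, b, 0, …, 0)`; the patterns `U = N³E³S³` (`uPt`, 10 points `uCoord`) and
  `V = N³ESENES³` (`vPt`, 12 points `vCoord`) in the `(x₁,x₂)`-plane, both from `(0,0)` to
  `(3,0)` inside the cube `Q = {0,…,3}^{d+2}` (`InCube`); adjacency, containment in `Q`,
  self-avoidance of the patterns.
* `OccU n ω k`, `OccV n ω k` — Definition 7.2.2: `(U, Q)` (resp. `(V, Q)`) occurs at the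
  `k`-th step of the `n`-step walk `ω` (the segment is the translate of the pattern by `ω(k)`
  and every other point of the walk lies outside `Q + ω(k)`).
* `insV k ω` / `delV k ω` — changing the occurrence of `(U,Q)` at `k` into one of `(V,Q)` and
  back: `insV_mem_saws`, `occV_insV`, `delV_mem_saws`, `occU_delV`, `delV_insV`, `insV_delV`.
* Occurrences never overlap (`occU_sep_occU`, `occV_sep_occV`, `occU_sep_occV`, by comparing the
  two descriptions of a point in the overlap, `seg_overlap`, case by case on the offset), and
  the two extra points `(1,2), (2,2)` of `V` enter no cube avoided by the points of `U`
  (`not_inCube_vPt`); hence the transformation keeps every other occurrence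
  (`occU_insV_of_lt/gt`, `occV_insV_of_lt/gt`, `occU_delV_of_lt/gt`, `occV_delV_of_lt/gt`) and
  **`ω' ∈ W_{N+2}(i-1, j+1)`**: `uCount_insV` (`I(ω') = I(ω) - 1`), `vCount_insV`
  (`J(ω') = J(ω) + 1`), where `uCount`/`vCount` count the occurrence steps `uSites`/`vSites`.
* Counting the allowed pairs in two ways (`uPairs`, `vPairs`, `sum_uPairs_eq_sum_vPairs`):
  **(7.3.6)** `sum_ratio_eq_card : Σ_{ω ∈ S_N} I/(J+1) = w_{N+2}(≥0, ≥1)` and the weak form of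
  **(7.3.7)** `sum_ratio₂_le : Σ_{ω ∈ S_N} I(I-1)/((J+1)(J+2)) ≤ Σ_{ω' ∈ S_{N+2}} I/(J+1)`
  (`≤ c_{N+4}`), which is all the proof needs.
* `thm732_of_patternBound` — **Theorem 7.3.2(a)** (`∃ D, ∀ᶠ N, φ_N² - D/N ≤ φ_N φ_{N+2}` on
  `ℤ^{d+2}`) from the pattern-theorem bound for `(V, Q)`: Schwarz (7.3.8) in the form
  `sq_sum_le_card_mul_sum_sq`, the term `Ξ_N` (7.3.10) bounded by `sum_xi_le` (pointwise
  `xi_term_le`: `I²/(J+1)² - I(I-1)/((J+1)(J+2)) = I(I+J+1)/((J+1)²(J+2))` is `O(1/N)` when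
  `J ≥ aN` and `O(N²)` otherwise), the term `S_N` (7.3.11) by `card_vCount_zero_le`.
* `BDGS2012_tendsto_count_ratio_two_of_patternBound` — **Kesten's ratio limit theorem
  `c_{N+2}/c_N → μ²` in all dimensions from the pattern-theorem bound for `(V,Q)` in all
  dimensions `≥ 2`** (with `BDGS2012_tendsto_count_ratio_two_of_thm732` of `SAWRatioLimit.lean`).

NOT here: Kesten's Pattern Theorem 7.2.3 itself (Madras–Slade §7.2: Lemmas 7.2.4–7.2.6, two
"triple countings" with cube surgery), hence not yet `BDGS2012_tendsto_count_ratio_two_holds`,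
which is `BDGS2012_tendsto_count_ratio_two_of_patternBound` applied to it.

## References

* N. Madras, G. Slade, *The Self-Avoiding Walk*, Birkhäuser (1993), Definition 7.2.2,
  Theorem 7.2.3, §7.3: Theorem 7.3.2 and its proof (7.3.5)–(7.3.12), Theorem 7.3.4(a), Fig. 7.4.
* H. Kesten, *On the number of self-avoiding walks*, J. Math. Phys. 4 (1963), 960–969.
-/

noncomputable section

open Filter Topology Literature.Probability.LatticeModels Literature.Probability.Percolation SimpleGraph
open scoped BigOperators

namespace Literature.Probability.RandomPlanarGeometry.SAW.Zd

section KestenPatterns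

variable {d : ℕ}

/-! #### Planar vectors in `ℤ^{d+2}` -/

/-- The vector `(a, b, 0, …, 0) ∈ ℤ^{d+2}` of the `(x₁, x₂)`-plane. [folklore] -/
def mk2 (a b : ℤ) : Site (d + 2) := Pi.single 0 a + Pi.single 1 b

/-- First coordinate of `mk2 a b`. [folklore] -/
@[simp] theorem mk2_apply_zero (a b : ℤ) : (mk2 a b : Site (d + 2)) 0 = a := by
  simp [mk2]

/-- Second coordinate of `mk2 a b`. [folklore] -/
@[simp] theorem mk2_apply_one (a b : ℤ) : (mk2 a b : Site (d + 2)) 1 = b := by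
  simp [mk2]

/-- The other coordinates of `mk2 a b` vanish. [folklore] -/
theorem mk2_apply_of_ne (a b : ℤ) {i : Fin (d + 2)} (h0 : i ≠ 0) (h1 : i ≠ 1) :
    (mk2 a b : Site (d + 2)) i = 0 := by
  simp [mk2, Pi.single_eq_of_ne h0, Pi.single_eq_of_ne h1]

/-- `mk2` is additive. [folklore] -/
theorem mk2_add (a b a' b' : ℤ) : (mk2 a b : Site (d + 2)) + mk2 a' b' = mk2 (a + a') (b + b') := by
  simp only [mk2, Pi.single_add]; abel

/-- `mk2 0 0 = 0`. [folklore] -/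
@[simp] theorem mk2_zero : (mk2 0 0 : Site (d + 2)) = 0 := by simp [mk2]

/-- `mk2` is injective. [folklore] -/
theorem mk2_inj {a b a' b' : ℤ} (h : (mk2 a b : Site (d + 2)) = mk2 a' b') : a = a' ∧ b = b' :=
  ⟨by simpa using congrFun h 0, by simpa using congrFun h 1⟩

/-- A unit step in the plane is an edge of `ℤ^{d+2}`. [folklore] -/
theorem adj_add_mk2 (x : Site (d + 2)) {a b a' b' : ℤ}
    (h : (a' = a + 1 ∧ b' = b) ∨ (a = a' + 1 ∧ b' = b) ∨ (a' = a ∧ b' = b + 1) ∨ (a' = a ∧ b = b' + 1)) :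
    (zdGraph (d + 2)).Adj (x + mk2 a b) (x + mk2 a' b') := by
  rw [zdGraph_adj_iff_sub]
  have e1 : x + (mk2 a' b' : Site (d + 2)) - (x + mk2 a b) = mk2 (a' - a) (b' - b) := by
    rw [add_sub_add_left_eq_sub, sub_eq_iff_eq_add, mk2_add]; congr 1 <;> ring
  have e2 : x + (mk2 a b : Site (d + 2)) - (x + mk2 a' b') = mk2 (a - a') (b - b') := by
    rw [add_sub_add_left_eq_sub, sub_eq_iff_eq_add, mk2_add]; congr 1 <;> ring
  rcases h with ⟨h1, h2⟩ | ⟨h1, h2⟩ | ⟨h1, h2⟩ | ⟨h1, h2⟩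
  · refine ⟨0, Or.inl ?_⟩; rw [e1, h1, h2]; simp [mk2]
  · refine ⟨0, Or.inr ?_⟩; rw [e2, h1, h2]; simp [mk2]
  · refine ⟨1, Or.inl ?_⟩; rw [e1, h1, h2]; simp [mk2]
  · refine ⟨1, Or.inr ?_⟩; rw [e2, h1, h2]; simp [mk2]

/-- The cube `Q + c = {x : 0 ≤ xᵢ - cᵢ ≤ 3}` of side `3` with lowest corner `c`
(Madras–Slade's `Q = {x ∈ ℤ^d : 0 ≤ xᵢ ≤ 3}`, translated). [cite: MadrasSlade1993, Theorem 7.3.2 (proof)] -/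
def InCube (c x : Site (d + 2)) : Prop := ∀ i, 0 ≤ x i - c i ∧ x i - c i ≤ 3

/-- Planar points of the cube. [folklore] -/
theorem inCube_add_mk2 (c : Site (d + 2)) (a b : ℤ) :
    InCube c (c + mk2 a b) ↔ 0 ≤ a ∧ a ≤ 3 ∧ 0 ≤ b ∧ b ≤ 3 := by
  constructor
  · intro h
    have h0 := h 0; have h1 := h 1
    simp only [Pi.add_apply, mk2_apply_zero, mk2_apply_one, add_sub_cancel_left] at h0 h1
    exact ⟨h0.1, h0.2, h1.1, h1.2⟩
  · rintro ⟨h1, h2, h3, h4⟩ i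
    simp only [Pi.add_apply, add_sub_cancel_left]
    by_cases hi0 : i = 0
    · subst hi0; simp [h1, h2]
    by_cases hi1 : i = 1
    · subst hi1; simp [h3, h4]
    rw [mk2_apply_of_ne a b hi0 hi1]; norm_num

/-! #### Kesten's patterns `U = N³E³S³` and `V = N³ESENES³` -/

/-- Planar coordinates of the points `u(0), …, u(9)` of the pattern `U = N³E³S³` (frozen at
`u(9) = (3,0)` afterwards). [cite: MadrasSlade1993, Theorem 7.3.2 (proof), Fig. 7.4] -/
def uCoord : ℕ → ℤ × ℤ
  | 0 => (0, 0) | 1 => (0, 1) | 2 => (0, 2) | 3 => (0, 3) | 4 => (1, 3) | 5 => (2, 3)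
  | 6 => (3, 3) | 7 => (3, 2) | 8 => (3, 1) | _ => (3, 0)

/-- Planar coordinates of the points `v(0), …, v(11)` of the pattern `V = N³ESENES³` (frozen
at `v(11) = (3,0)` afterwards). [cite: MadrasSlade1993, Theorem 7.3.2 (proof), Fig. 7.4] -/
def vCoord : ℕ → ℤ × ℤ
  | 0 => (0, 0) | 1 => (0, 1) | 2 => (0, 2) | 3 => (0, 3) | 4 => (1, 3) | 5 => (1, 2)
  | 6 => (2, 2) | 7 => (2, 3) | 8 => (3, 3) | 9 => (3, 2) | 10 => (3, 1) | _ => (3, 0)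

/-- The points of `U` in `ℤ^{d+2}` (in the `(x₁,x₂)`-plane). [cite: MadrasSlade1993, Theorem 7.3.2 (proof)] -/
def uPt (t : ℕ) : Site (d + 2) := mk2 (uCoord t).1 (uCoord t).2

/-- The points of `V` in `ℤ^{d+2}` (in the `(x₁,x₂)`-plane). [cite: MadrasSlade1993, Theorem 7.3.2 (proof)] -/
def vPt (t : ℕ) : Site (d + 2) := mk2 (vCoord t).1 (vCoord t).2

/-- `u(0) = 0`. [folklore] -/
@[simp] theorem uPt_zero : (uPt 0 : Site (d + 2)) = 0 := by simp [uPt, uCoord]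

/-- `v(0) = 0`. [folklore] -/
@[simp] theorem vPt_zero : (vPt 0 : Site (d + 2)) = 0 := by simp [vPt, vCoord]

/-- `U` and `V` have the same endpoints: `v(11) = u(9) = (3, 0)`. [cite: MadrasSlade1993, Theorem 7.3.2 (proof)] -/
theorem vPt_eleven : (vPt 11 : Site (d + 2)) = uPt 9 := by simp [vPt, uPt, vCoord, uCoord]

/-- Values of `u` beyond `9` are frozen. [folklore] -/
theorem uCoord_of_ge {t : ℕ} (ht : 9 ≤ t) : uCoord t = (3, 0) := by
  match t, ht with
  | n + 9, _ => rfl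

/-- Values of `v` beyond `11` are frozen. [folklore] -/
theorem vCoord_of_ge {t : ℕ} (ht : 11 ≤ t) : vCoord t = (3, 0) := by
  match t, ht with
  | n + 11, _ => rfl

/-- Consecutive points of `U` are nearest neighbours. [folklore] -/
theorem adj_uPt (x : Site (d + 2)) {t : ℕ} (ht : t < 9) :
    (zdGraph (d + 2)).Adj (x + uPt t) (x + uPt (t + 1)) := by
  unfold uPt
  interval_cases t <;> exact adj_add_mk2 x (by simp [uCoord])

/-- Consecutive points of `V` are nearest neighbours. [folklore] -/
theorem adj_vPt (x : Site (d + 2)) {t : ℕ} (ht : t < 11) :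
    (zdGraph (d + 2)).Adj (x + vPt t) (x + vPt (t + 1)) := by
  unfold vPt
  interval_cases t <;> exact adj_add_mk2 x (by simp [vCoord])

/-- `U` lies in the cube `Q`. [folklore] -/
theorem inCube_uPt (c : Site (d + 2)) (t : ℕ) : InCube c (c + uPt t) := by
  unfold uPt
  rw [inCube_add_mk2]
  rcases Nat.lt_or_ge t 9 with ht | ht
  · interval_cases t <;> simp [uCoord]
  · rw [uCoord_of_ge ht]; norm_num

/-- `V` lies in the cube `Q`. [folklore] -/
theorem inCube_vPt (c : Site (d + 2)) (t : ℕ) : InCube c (c + vPt t) := by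
  unfold vPt
  rw [inCube_add_mk2]
  rcases Nat.lt_or_ge t 11 with ht | ht
  · interval_cases t <;> simp [vCoord]
  · rw [vCoord_of_ge ht]; norm_num

/-- `U` is self-avoiding. [folklore] -/
theorem uCoord_injOn {s t : ℕ} (hs : s ≤ 9) (ht : t ≤ 9) (h : uCoord s = uCoord t) : s = t := by
  interval_cases s <;> interval_cases t <;> simp_all [uCoord]

/-- `V` is self-avoiding. [folklore] -/
theorem vCoord_injOn {s t : ℕ} (hs : s ≤ 11) (ht : t ≤ 11) (h : vCoord s = vCoord t) : s = t := by
  interval_cases s <;> interval_cases t <;> simp_all [vCoord]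

/-- `U` is self-avoiding (points of `ℤ^{d+2}`). [folklore] -/
theorem uPt_injOn (x : Site (d + 2)) {s t : ℕ} (hs : s ≤ 9) (ht : t ≤ 9)
    (h : x + uPt s = x + uPt t) : s = t := by
  have h' := mk2_inj (add_left_cancel h)
  exact uCoord_injOn hs ht (Prod.ext h'.1 h'.2)

/-- `V` is self-avoiding (points of `ℤ^{d+2}`). [folklore] -/
theorem vPt_injOn (x : Site (d + 2)) {s t : ℕ} (hs : s ≤ 11) (ht : t ≤ 11)
    (h : x + vPt s = x + vPt t) : s = t := by
  have h' := mk2_inj (add_left_cancel h)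
  exact vCoord_injOn hs ht (Prod.ext h'.1 h'.2)

/-! #### Occurrences of `(U, Q)` and `(V, Q)` (Madras–Slade Definition 7.2.2) -/

/-- **`(U, Q)` occurs at the `k`-th step of the `n`-step walk `ω`**: `ω(k + t) = ω(k) + u(t)` for
`t = 0, …, 9`, and `ω(i)` is not in the cube `Q + ω(k)` for `i < k` and for `k + 9 < i ≤ n`.
[cite: MadrasSlade1993, Definition 7.2.2] -/
def OccU (n : ℕ) (ω : ℕ → Site (d + 2)) (k : ℕ) : Prop :=
  k + 9 ≤ n ∧ (∀ t ≤ 9, ω (k + t) = ω k + uPt t) ∧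
    ∀ i ≤ n, (i < k ∨ k + 9 < i) → ¬ InCube (ω k) (ω i)

/-- **`(V, Q)` occurs at the `k`-th step of the `n`-step walk `ω`**: `ω(k + t) = ω(k) + v(t)` for
`t = 0, …, 11`, and `ω(i)` is not in the cube `Q + ω(k)` for `i < k` and for `k + 11 < i ≤ n`.
[cite: MadrasSlade1993, Definition 7.2.2] -/
def OccV (n : ℕ) (ω : ℕ → Site (d + 2)) (k : ℕ) : Prop :=
  k + 11 ≤ n ∧ (∀ t ≤ 11, ω (k + t) = ω k + vPt t) ∧
    ∀ i ≤ n, (i < k ∨ k + 11 < i) → ¬ InCube (ω k) (ω i)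

/-! #### Changing a `U` into a `V` and back -/

/-- **The basic transformation of Theorem 7.3.2**: the occurrence of `(U, Q)` at step `k` is
changed into an occurrence of `(V, Q)` ("`ω(l) = ω'(l)` for `l ≤ k` and `ω(l) = ω'(l + 2)` for
`l ≥ k + 9`"), increasing the length by two. [cite: MadrasSlade1993, Theorem 7.3.2 (proof)] -/
def insV (k : ℕ) (ω : ℕ → Site (d + 2)) : ℕ → Site (d + 2) := fun t =>
  if t ≤ k then ω t else if t ≤ k + 11 then ω k + vPt (t - k) else ω (t - 2)

/-- The inverse transformation: the occurrence of `(V, Q)` at step `k` is changed back into an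
occurrence of `(U, Q)`. [cite: MadrasSlade1993, Theorem 7.3.2 (proof)] -/
def delV (k : ℕ) (ω : ℕ → Site (d + 2)) : ℕ → Site (d + 2) := fun t =>
  if t ≤ k then ω t else if t ≤ k + 9 then ω k + uPt (t - k) else ω (t + 2)

section Values

variable (k : ℕ) (ω : ℕ → Site (d + 2))

/-- `insV` before the pattern. [folklore] -/
theorem insV_apply_of_le {t : ℕ} (h : t ≤ k) : insV k ω t = ω t := by simp [insV, h]

/-- `insV` on the pattern window `[k, k + 11]`. [folklore] -/
theorem insV_apply_window {t : ℕ} (ht : t ≤ 11) : insV k ω (k + t) = ω k + vPt t := by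
  rcases Nat.eq_zero_or_pos t with rfl | hpos
  · simp [insV]
  · simp only [insV, if_neg (show ¬ k + t ≤ k by omega), if_pos (show k + t ≤ k + 11 by omega),
      Nat.add_sub_cancel_left]

/-- `insV` after the pattern. [folklore] -/
theorem insV_apply_of_gt {t : ℕ} (h : k + 11 < t) : insV k ω t = ω (t - 2) := by
  simp only [insV, if_neg (show ¬ t ≤ k by omega), if_neg (show ¬ t ≤ k + 11 by omega)]

/-- `delV` before the pattern. [folklore] -/
theorem delV_apply_of_le {t : ℕ} (h : t ≤ k) : delV k ω t = ω t := by simp [delV, h]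

/-- `delV` on the pattern window `[k, k + 9]`. [folklore] -/
theorem delV_apply_window {t : ℕ} (ht : t ≤ 9) : delV k ω (k + t) = ω k + uPt t := by
  rcases Nat.eq_zero_or_pos t with rfl | hpos
  · simp [delV]
  · simp only [delV, if_neg (show ¬ k + t ≤ k by omega), if_pos (show k + t ≤ k + 9 by omega),
      Nat.add_sub_cancel_left]

/-- `delV` after the pattern. [folklore] -/
theorem delV_apply_of_gt {t : ℕ} (h : k + 9 < t) : delV k ω t = ω (t + 2) := by
  simp only [delV, if_neg (show ¬ t ≤ k by omega), if_neg (show ¬ t ≤ k + 9 by omega)]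

end Values

/-- The transformed walk is an `(n+2)`-step self-avoiding walk: the points of `V + ω(k)` are
distinct points of the cube `Q + ω(k)`, which the rest of the walk avoids.
[cite: MadrasSlade1993, Theorem 7.3.2 (proof)] -/
theorem insV_mem_saws {n k : ℕ} {ω : ℕ → Site (d + 2)} (hω : ω ∈ saws (d + 2) n)
    (hk : OccU n ω k) : insV k ω ∈ saws (d + 2) (n + 2) := by
  obtain ⟨h0, hend, hadj, hinj⟩ := mem_saws.1 hω
  obtain ⟨hkn, hseg, havoid⟩ := hk
  have hend' : insV k ω (k + 11) = ω (k + 9) := by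
    rw [insV_apply_window k ω le_rfl, vPt_eleven, ← hseg 9 le_rfl]
  -- values at "old" times after the window, including the junction `k + 11`
  have hold : ∀ t, k + 11 ≤ t → insV k ω t = ω (t - 2) := by
    intro t ht
    rcases ht.eq_or_lt with rfl | ht'
    · rw [hend', show k + 11 - 2 = k + 9 by omega]
    · exact insV_apply_of_gt k ω ht'
  refine mem_saws.2 ⟨by rw [insV_apply_of_le k ω (Nat.zero_le k), h0], ?_, ?_, ?_⟩
  · intro t ht
    rw [hold t (by omega), hold (n + 2) (by omega), hend (t - 2) (by omega),
      show n + 2 - 2 = n from rfl]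
  · intro t ht
    rcases (show t < k ∨ (k ≤ t ∧ t < k + 11) ∨ k + 11 ≤ t by omega) with h | ⟨h1, h2⟩ | h
    · rw [insV_apply_of_le k ω h.le, insV_apply_of_le k ω (by omega)]
      exact hadj t (by omega)
    · obtain ⟨s, rfl⟩ : ∃ s, t = k + s := ⟨t - k, by omega⟩
      rw [insV_apply_window k ω (by omega), show k + s + 1 = k + (s + 1) by ring,
        insV_apply_window k ω (by omega)]
      exact adj_vPt _ (by omega)
    · rw [hold t h, hold (t + 1) (by omega), show t + 1 - 2 = t - 2 + 1 by omega]
      exact hadj (t - 2) (by omega)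
  · -- self-avoidance
    intro s hs t ht hst
    simp only [Set.mem_setOf_eq] at hs ht
    -- classify the two times: window `[k, k+11]` (pattern points, in the cube) or not
    have hwin : ∀ r, k ≤ r → r ≤ k + 11 → insV k ω r = ω k + vPt (r - k) := fun r h1 h2 => by
      obtain ⟨s, rfl⟩ : ∃ s, r = k + s := ⟨r - k, by omega⟩
      rw [insV_apply_window k ω (by omega), Nat.add_sub_cancel_left]
    have hout_lt : ∀ r, r < k → insV k ω r = ω r ∧ ¬ InCube (ω k) (ω r) := fun r hr =>
      ⟨insV_apply_of_le k ω hr.le, havoid r (by omega) (Or.inl hr)⟩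
    have hout_gt : ∀ r, k + 11 < r → r ≤ n + 2 →
        insV k ω r = ω (r - 2) ∧ ¬ InCube (ω k) (ω (r - 2)) := fun r hr hr' =>
      ⟨insV_apply_of_gt k ω hr, havoid (r - 2) (by omega) (Or.inr (by omega))⟩
    rcases (show s < k ∨ (k ≤ s ∧ s ≤ k + 11) ∨ k + 11 < s by omega) with h | ⟨h1, h2⟩ | h <;>
    rcases (show t < k ∨ (k ≤ t ∧ t ≤ k + 11) ∨ k + 11 < t by omega) with h' | ⟨h1', h2'⟩ | h'
    · rw [(hout_lt s h).1, (hout_lt t h').1] at hst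
      exact hinj (show s ≤ n by omega) (show t ≤ n by omega) hst
    · exfalso
      rw [(hout_lt s h).1, hwin t h1' h2'] at hst
      exact (hout_lt s h).2 (hst ▸ inCube_vPt _ _)
    · rw [(hout_lt s h).1, (hout_gt t h' ht).1] at hst
      have := hinj (show s ≤ n by omega) (show t - 2 ≤ n by omega) hst
      omega
    · exfalso
      rw [hwin s h1 h2, (hout_lt t h').1] at hst
      exact (hout_lt t h').2 (hst ▸ inCube_vPt _ _)
    · rw [hwin s h1 h2, hwin t h1' h2'] at hst
      have := vPt_injOn (ω k) (by omega) (by omega) hst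
      omega
    · exfalso
      rw [hwin s h1 h2, (hout_gt t h' ht).1] at hst
      exact (hout_gt t h' ht).2 (hst ▸ inCube_vPt _ _)
    · rw [(hout_gt s h hs).1, (hout_lt t h').1] at hst
      have := hinj (show s - 2 ≤ n by omega) (show t ≤ n by omega) hst
      omega
    · exfalso
      rw [(hout_gt s h hs).1, hwin t h1' h2'] at hst
      exact (hout_gt s h hs).2 (hst ▸ inCube_vPt _ _)
    · rw [(hout_gt s h hs).1, (hout_gt t h' ht).1] at hst
      have := hinj (show s - 2 ≤ n by omega) (show t - 2 ≤ n by omega) hst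
      omega

/-- After the transformation, `(V, Q)` occurs at step `k`. [cite: MadrasSlade1993, Theorem 7.3.2 (proof)] -/
theorem occV_insV {n k : ℕ} {ω : ℕ → Site (d + 2)} (hk : OccU n ω k) :
    OccV (n + 2) (insV k ω) k := by
  obtain ⟨hkn, hseg, havoid⟩ := hk
  have hk0 : insV k ω k = ω k := insV_apply_of_le k ω le_rfl
  refine ⟨by omega, fun t ht => by rw [insV_apply_window k ω ht, hk0], ?_⟩
  intro i hi hi'
  rw [hk0]
  rcases hi' with h | h
  · rw [insV_apply_of_le k ω h.le]
    exact havoid i (by omega) (Or.inl h)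
  · rw [insV_apply_of_gt k ω h]
    exact havoid (i - 2) (by omega) (Or.inr (by omega))

/-- The inverse transformation gives an `n`-step self-avoiding walk.
[cite: MadrasSlade1993, Theorem 7.3.2 (proof)] -/
theorem delV_mem_saws {n k : ℕ} {ω : ℕ → Site (d + 2)} (hω : ω ∈ saws (d + 2) (n + 2))
    (hk : OccV (n + 2) ω k) : delV k ω ∈ saws (d + 2) n := by
  obtain ⟨h0, hend, hadj, hinj⟩ := mem_saws.1 hω
  obtain ⟨hkn, hseg, havoid⟩ := hk
  have hend' : delV k ω (k + 9) = ω (k + 11) := by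
    rw [delV_apply_window k ω le_rfl, ← vPt_eleven, ← hseg 11 le_rfl]
  have hold : ∀ t, k + 9 ≤ t → delV k ω t = ω (t + 2) := by
    intro t ht
    rcases ht.eq_or_lt with rfl | ht'
    · rw [hend']
    · exact delV_apply_of_gt k ω ht'
  refine mem_saws.2 ⟨by rw [delV_apply_of_le k ω (Nat.zero_le k), h0], ?_, ?_, ?_⟩
  · intro t ht
    rw [hold t (by omega), hold n (by omega), hend (t + 2) (by omega)]
  · intro t ht
    rcases (show t < k ∨ (k ≤ t ∧ t < k + 9) ∨ k + 9 ≤ t by omega) with h | ⟨h1, h2⟩ | h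
    · rw [delV_apply_of_le k ω h.le, delV_apply_of_le k ω (by omega)]
      exact hadj t (by omega)
    · obtain ⟨s, rfl⟩ : ∃ s, t = k + s := ⟨t - k, by omega⟩
      rw [delV_apply_window k ω (by omega), show k + s + 1 = k + (s + 1) by ring,
        delV_apply_window k ω (by omega)]
      exact adj_uPt _ (by omega)
    · rw [hold t h, hold (t + 1) (by omega), show t + 1 + 2 = t + 2 + 1 by ring]
      exact hadj (t + 2) (by omega)
  · intro s hs t ht hst
    simp only [Set.mem_setOf_eq] at hs ht
    have hwin : ∀ r, k ≤ r → r ≤ k + 9 → delV k ω r = ω k + uPt (r - k) := fun r h1 h2 => by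
      obtain ⟨s, rfl⟩ : ∃ s, r = k + s := ⟨r - k, by omega⟩
      rw [delV_apply_window k ω (by omega), Nat.add_sub_cancel_left]
    have hout_lt : ∀ r, r < k → delV k ω r = ω r ∧ ¬ InCube (ω k) (ω r) := fun r hr =>
      ⟨delV_apply_of_le k ω hr.le, havoid r (by omega) (Or.inl hr)⟩
    have hout_gt : ∀ r, k + 9 < r → r ≤ n →
        delV k ω r = ω (r + 2) ∧ ¬ InCube (ω k) (ω (r + 2)) := fun r hr hr' =>
      ⟨delV_apply_of_gt k ω hr, havoid (r + 2) (by omega) (Or.inr (by omega))⟩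
    rcases (show s < k ∨ (k ≤ s ∧ s ≤ k + 9) ∨ k + 9 < s by omega) with h | ⟨h1, h2⟩ | h <;>
    rcases (show t < k ∨ (k ≤ t ∧ t ≤ k + 9) ∨ k + 9 < t by omega) with h' | ⟨h1', h2'⟩ | h'
    · rw [(hout_lt s h).1, (hout_lt t h').1] at hst
      exact hinj (show s ≤ n + 2 by omega) (show t ≤ n + 2 by omega) hst
    · exfalso
      rw [(hout_lt s h).1, hwin t h1' h2'] at hst
      exact (hout_lt s h).2 (hst ▸ inCube_uPt _ _)
    · rw [(hout_lt s h).1, (hout_gt t h' ht).1] at hst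
      have := hinj (show s ≤ n + 2 by omega) (show t + 2 ≤ n + 2 by omega) hst
      omega
    · exfalso
      rw [hwin s h1 h2, (hout_lt t h').1] at hst
      exact (hout_lt t h').2 (hst ▸ inCube_uPt _ _)
    · rw [hwin s h1 h2, hwin t h1' h2'] at hst
      have := uPt_injOn (ω k) (by omega) (by omega) hst
      omega
    · exfalso
      rw [hwin s h1 h2, (hout_gt t h' ht).1] at hst
      exact (hout_gt t h' ht).2 (hst ▸ inCube_uPt _ _)
    · rw [(hout_gt s h hs).1, (hout_lt t h').1] at hst
      have := hinj (show s + 2 ≤ n + 2 by omega) (show t ≤ n + 2 by omega) hst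
      omega
    · exfalso
      rw [(hout_gt s h hs).1, hwin t h1' h2'] at hst
      exact (hout_gt s h hs).2 (hst ▸ inCube_uPt _ _)
    · rw [(hout_gt s h hs).1, (hout_gt t h' ht).1] at hst
      have := hinj (show s + 2 ≤ n + 2 by omega) (show t + 2 ≤ n + 2 by omega) hst
      omega

/-- After the inverse transformation, `(U, Q)` occurs at step `k`. [cite: MadrasSlade1993, Theorem 7.3.2 (proof)] -/
theorem occU_delV {n k : ℕ} {ω : ℕ → Site (d + 2)} (hk : OccV (n + 2) ω k) :
    OccU n (delV k ω) k := by
  obtain ⟨hkn, hseg, havoid⟩ := hk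
  have hk0 : delV k ω k = ω k := delV_apply_of_le k ω le_rfl
  refine ⟨by omega, fun t ht => by rw [delV_apply_window k ω ht, hk0], ?_⟩
  intro i hi hi'
  rw [hk0]
  rcases hi' with h | h
  · rw [delV_apply_of_le k ω h.le]
    exact havoid i (by omega) (Or.inl h)
  · rw [delV_apply_of_gt k ω h]
    exact havoid (i + 2) (by omega) (Or.inr (by omega))

/-- `delV k` undoes `insV k` at an occurrence of `(U, Q)`. [folklore] -/
theorem delV_insV {n k : ℕ} {ω : ℕ → Site (d + 2)} (hk : OccU n ω k) : delV k (insV k ω) = ω := by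
  obtain ⟨-, hseg, -⟩ := hk
  funext t
  rcases (show t ≤ k ∨ (k < t ∧ t ≤ k + 9) ∨ k + 9 < t by omega) with h | ⟨h1, h2⟩ | h
  · rw [delV_apply_of_le k _ h, insV_apply_of_le k ω h]
  · obtain ⟨s, rfl⟩ : ∃ s, t = k + s := ⟨t - k, by omega⟩
    rw [delV_apply_window k _ (by omega), insV_apply_of_le k ω le_rfl, hseg s (by omega)]
  · rw [delV_apply_of_gt k _ h, insV_apply_of_gt k ω (by omega), Nat.add_sub_cancel]

/-- `insV k` undoes `delV k` at an occurrence of `(V, Q)`. [folklore] -/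
theorem insV_delV {n k : ℕ} {ω : ℕ → Site (d + 2)} (hk : OccV n ω k) : insV k (delV k ω) = ω := by
  obtain ⟨-, hseg, -⟩ := hk
  funext t
  rcases (show t ≤ k ∨ (k < t ∧ t ≤ k + 11) ∨ k + 11 < t by omega) with h | ⟨h1, h2⟩ | h
  · rw [insV_apply_of_le k _ h, delV_apply_of_le k ω h]
  · obtain ⟨s, rfl⟩ : ∃ s, t = k + s := ⟨t - k, by omega⟩
    rw [insV_apply_window k _ (by omega), delV_apply_of_le k ω le_rfl, hseg s (by omega)]
  · rw [insV_apply_of_gt k _ h, delV_apply_of_gt k ω (by omega), Nat.sub_add_cancel (by omega)]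

/-! #### Occurrences do not overlap -/

section Overlap

variable {n : ℕ} {ω : ℕ → Site (d + 2)} {k : ℕ}

/-- Bookkeeping for two overlapping pattern segments: comparing the two descriptions of the
point at time `k + s + t`. [folklore] -/
theorem seg_overlap {P R : ℕ → Site (d + 2)} {s t : ℕ} (h3 : ω (k + s) = ω k + P s)
    (h1 : ω (k + (s + t)) = ω k + P (s + t)) (h2 : ω (k + s + t) = ω (k + s) + R t) :
    P (s + t) = P s + R t := by
  rw [h3, add_assoc k s t, h1, add_assoc] at h2
  exact add_left_cancel h2

/-- The point `ω(k) + (3, 1)` lies in the cube `Q + ω(k)`. [folklore] -/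
theorem inCube_three_one (c : Site (d + 2)) : InCube c (c + mk2 3 1) := by
  rw [inCube_add_mk2]; norm_num

/-- Two occurrences of `(U, Q)` on a walk do not overlap. [cite: MadrasSlade1993, Theorem 7.3.2 (proof)] -/
theorem occU_occU_disjoint (hk : OccU n ω k) {s : ℕ} (hs1 : 1 ≤ s) (hs9 : s ≤ 9)
    (hk' : OccU n ω (k + s)) : False := by
  obtain ⟨hkn, hseg, havoid⟩ := hk
  obtain ⟨hkn', hseg', -⟩ := hk'
  have h3 := hseg s hs9
  rcases (show s = 1 ∨ s = 2 ∨ (3 ≤ s ∧ s ≤ 8) ∨ s = 9 by omega) with rfl | rfl | ⟨hs3, hs8⟩ | rfl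
  · -- `s = 1`: compare the point at time `k + 4`
    have h := seg_overlap (t := 3) h3 (hseg 4 (by norm_num)) (hseg' 3 (by norm_num))
    simp [uPt, uCoord, mk2_add] at h
    obtain ⟨e1, e2⟩ := mk2_inj h; omega
  · -- `s = 2`: compare the point at time `k + 4`
    have h := seg_overlap (t := 2) h3 (hseg 4 (by norm_num)) (hseg' 2 (by norm_num))
    simp [uPt, uCoord, mk2_add] at h
    obtain ⟨e1, e2⟩ := mk2_inj h; omega
  · -- `3 ≤ s ≤ 8`: compare the point at time `k + s + 1`
    have h := seg_overlap h3 (hseg (s + 1) (by omega)) (hseg' 1 (by norm_num))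
    interval_cases s <;> simp [uPt, uCoord, mk2_add] at h <;> (obtain ⟨e1, e2⟩ := mk2_inj h; omega)
  · -- `s = 9`: the point at time `k + 10` is `ω(k) + (3, 1) ∈ Q + ω(k)`
    have h := hseg' 1 (by norm_num)
    rw [h3] at h
    refine havoid (k + 9 + 1) (by omega) (Or.inr (by omega)) ?_
    rw [h, add_assoc, show (uPt 9 : Site (d + 2)) + uPt 1 = mk2 3 1 by simp [uPt, uCoord, mk2_add]]
    exact inCube_three_one _

/-- Two occurrences of `(V, Q)` on a walk do not overlap. [cite: MadrasSlade1993, Theorem 7.3.2 (proof)] -/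
theorem occV_occV_disjoint (hk : OccV n ω k) {s : ℕ} (hs1 : 1 ≤ s) (hs11 : s ≤ 11)
    (hk' : OccV n ω (k + s)) : False := by
  obtain ⟨hkn, hseg, havoid⟩ := hk
  obtain ⟨hkn', hseg', -⟩ := hk'
  have h3 := hseg s hs11
  rcases (show s = 1 ∨ s = 2 ∨ (3 ≤ s ∧ s ≤ 10 ∧ s ≠ 6) ∨ s = 6 ∨ s = 11 by omega) with
    rfl | rfl | ⟨hs3, hs10, hs6⟩ | rfl | rfl
  · have h := seg_overlap (t := 3) h3 (hseg 4 (by norm_num)) (hseg' 3 (by norm_num))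
    simp [vPt, vCoord, mk2_add] at h
    obtain ⟨e1, e2⟩ := mk2_inj h; omega
  · have h := seg_overlap (t := 2) h3 (hseg 4 (by norm_num)) (hseg' 2 (by norm_num))
    simp [vPt, vCoord, mk2_add] at h
    obtain ⟨e1, e2⟩ := mk2_inj h; omega
  · have h := seg_overlap h3 (hseg (s + 1) (by omega)) (hseg' 1 (by norm_num))
    interval_cases s <;> simp [vPt, vCoord, mk2_add] at h hs6 <;>
      (obtain ⟨e1, e2⟩ := mk2_inj h; omega)
  · have h := seg_overlap h3 (hseg 8 (by norm_num)) (hseg' 2 (by norm_num))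
    simp [vPt, vCoord, mk2_add] at h
    obtain ⟨e1, e2⟩ := mk2_inj h; omega
  · have h := hseg' 1 (by norm_num)
    rw [h3] at h
    refine havoid (k + 11 + 1) (by omega) (Or.inr (by omega)) ?_
    rw [h, add_assoc, show (vPt 11 : Site (d + 2)) + vPt 1 = mk2 3 1 by simp [vPt, vCoord, mk2_add]]
    exact inCube_three_one _

/-- An occurrence of `(V, Q)` does not overlap a preceding occurrence of `(U, Q)`.
[cite: MadrasSlade1993, Theorem 7.3.2 (proof)] -/
theorem occU_occV_disjoint (hk : OccU n ω k) {s : ℕ} (hs1 : 1 ≤ s) (hs9 : s ≤ 9)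
    (hk' : OccV n ω (k + s)) : False := by
  obtain ⟨hkn, hseg, havoid⟩ := hk
  obtain ⟨hkn', hseg', -⟩ := hk'
  have h3 := hseg s hs9
  rcases (show s = 1 ∨ s = 2 ∨ (3 ≤ s ∧ s ≤ 8) ∨ s = 9 by omega) with rfl | rfl | ⟨hs3, hs8⟩ | rfl
  · have h := seg_overlap (t := 3) h3 (hseg 4 (by norm_num)) (hseg' 3 (by norm_num))
    simp [uPt, vPt, uCoord, vCoord, mk2_add] at h
    obtain ⟨e1, e2⟩ := mk2_inj h; omega
  · have h := seg_overlap (t := 2) h3 (hseg 4 (by norm_num)) (hseg' 2 (by norm_num))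
    simp [uPt, vPt, uCoord, vCoord, mk2_add] at h
    obtain ⟨e1, e2⟩ := mk2_inj h; omega
  · have h := seg_overlap h3 (hseg (s + 1) (by omega)) (hseg' 1 (by norm_num))
    interval_cases s <;> simp [uPt, vPt, uCoord, vCoord, mk2_add] at h <;>
      (obtain ⟨e1, e2⟩ := mk2_inj h; omega)
  · have h := hseg' 1 (by norm_num)
    rw [h3] at h
    refine havoid (k + 9 + 1) (by omega) (Or.inr (by omega)) ?_
    rw [h, add_assoc, show (uPt 9 : Site (d + 2)) + vPt 1 = mk2 3 1 by
      simp [uPt, vPt, uCoord, vCoord, mk2_add]]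
    exact inCube_three_one _

/-- An occurrence of `(U, Q)` does not overlap a preceding occurrence of `(V, Q)`.
[cite: MadrasSlade1993, Theorem 7.3.2 (proof)] -/
theorem occV_occU_disjoint (hk : OccV n ω k) {s : ℕ} (hs1 : 1 ≤ s) (hs11 : s ≤ 11)
    (hk' : OccU n ω (k + s)) : False := by
  obtain ⟨hkn, hseg, havoid⟩ := hk
  obtain ⟨hkn', hseg', -⟩ := hk'
  have h3 := hseg s hs11
  rcases (show s = 1 ∨ s = 2 ∨ (3 ≤ s ∧ s ≤ 10 ∧ s ≠ 6) ∨ s = 6 ∨ s = 11 by omega) with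
    rfl | rfl | ⟨hs3, hs10, hs6⟩ | rfl | rfl
  · have h := seg_overlap (t := 3) h3 (hseg 4 (by norm_num)) (hseg' 3 (by norm_num))
    simp [uPt, vPt, uCoord, vCoord, mk2_add] at h
    obtain ⟨e1, e2⟩ := mk2_inj h; omega
  · have h := seg_overlap (t := 2) h3 (hseg 4 (by norm_num)) (hseg' 2 (by norm_num))
    simp [uPt, vPt, uCoord, vCoord, mk2_add] at h
    obtain ⟨e1, e2⟩ := mk2_inj h; omega
  · have h := seg_overlap h3 (hseg (s + 1) (by omega)) (hseg' 1 (by norm_num))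
    interval_cases s <;> simp [uPt, vPt, uCoord, vCoord, mk2_add] at h hs6 <;>
      (obtain ⟨e1, e2⟩ := mk2_inj h; omega)
  · have h := seg_overlap h3 (hseg 8 (by norm_num)) (hseg' 2 (by norm_num))
    simp [uPt, vPt, uCoord, vCoord, mk2_add] at h
    obtain ⟨e1, e2⟩ := mk2_inj h; omega
  · have h := hseg' 1 (by norm_num)
    rw [h3] at h
    refine havoid (k + 11 + 1) (by omega) (Or.inr (by omega)) ?_
    rw [h, add_assoc, show (vPt 11 : Site (d + 2)) + uPt 1 = mk2 3 1 by
      simp [uPt, vPt, uCoord, vCoord, mk2_add]]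
    exact inCube_three_one _

/-- Distinct occurrences of `(U, Q)` have disjoint windows. [cite: MadrasSlade1993, Theorem 7.3.2 (proof)] -/
theorem occU_sep_occU {k' : ℕ} (hk : OccU n ω k) (hk' : OccU n ω k') (hne : k ≠ k') :
    k + 9 < k' ∨ k' + 9 < k := by
  by_contra h
  push Not at h
  rcases lt_or_gt_of_ne hne with hlt | hlt
  · obtain ⟨s, rfl⟩ : ∃ s, k' = k + s := ⟨k' - k, by omega⟩
    exact occU_occU_disjoint hk (by omega) (by omega) hk'
  · obtain ⟨s, rfl⟩ : ∃ s, k = k' + s := ⟨k - k', by omega⟩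
    exact occU_occU_disjoint hk' (by omega) (by omega) hk

/-- Distinct occurrences of `(V, Q)` have disjoint windows. [cite: MadrasSlade1993, Theorem 7.3.2 (proof)] -/
theorem occV_sep_occV {k' : ℕ} (hk : OccV n ω k) (hk' : OccV n ω k') (hne : k ≠ k') :
    k + 11 < k' ∨ k' + 11 < k := by
  by_contra h
  push Not at h
  rcases lt_or_gt_of_ne hne with hlt | hlt
  · obtain ⟨s, rfl⟩ : ∃ s, k' = k + s := ⟨k' - k, by omega⟩
    exact occV_occV_disjoint hk (by omega) (by omega) hk'
  · obtain ⟨s, rfl⟩ : ∃ s, k = k' + s := ⟨k - k', by omega⟩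
    exact occV_occV_disjoint hk' (by omega) (by omega) hk

/-- `(U, Q)` and `(V, Q)` cannot occur at the same step. [folklore] -/
theorem not_occU_occV (hk : OccU n ω k) (hk' : OccV n ω k) : False := by
  have h1 := hk.2.1 5 (by norm_num)
  have h2 := hk'.2.1 5 (by norm_num)
  rw [h1] at h2
  have := mk2_inj (add_left_cancel h2)
  simp [uCoord, vCoord] at this

/-- Occurrences of `(U, Q)` and `(V, Q)` have disjoint windows. [cite: MadrasSlade1993, Theorem 7.3.2 (proof)] -/
theorem occU_sep_occV {k' : ℕ} (hk : OccU n ω k) (hk' : OccV n ω k') :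
    k + 9 < k' ∨ k' + 11 < k := by
  by_contra h
  push Not at h
  rcases lt_trichotomy k k' with hlt | rfl | hlt
  · obtain ⟨s, rfl⟩ : ∃ s, k' = k + s := ⟨k' - k, by omega⟩
    exact occU_occV_disjoint hk (by omega) (by omega) hk'
  · exact not_occU_occV hk hk'
  · obtain ⟨s, rfl⟩ : ∃ s, k = k' + s := ⟨k - k', by omega⟩
    exact occV_occU_disjoint hk' (by omega) (by omega) hk

end Overlap

/-! #### The transformation changes no other occurrence -/

section Preserve

variable {n k k' : ℕ} {ω : ℕ → Site (d + 2)}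

/-- Coordinates form of membership in the cube for planar translates. [folklore] -/
theorem inCube_add_mk2' (c x : Site (d + 2)) (a b : ℤ) :
    InCube c (x + mk2 a b) ↔ (0 ≤ x 0 + a - c 0 ∧ x 0 + a - c 0 ≤ 3) ∧
      (0 ≤ x 1 + b - c 1 ∧ x 1 + b - c 1 ≤ 3) ∧
      ∀ i, i ≠ 0 → i ≠ 1 → 0 ≤ x i - c i ∧ x i - c i ≤ 3 := by
  constructor
  · intro h
    refine ⟨by simpa using h 0, by simpa using h 1, fun i hi0 hi1 => ?_⟩
    have := h i
    rwa [Pi.add_apply, mk2_apply_of_ne a b hi0 hi1, add_zero] at this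
  · rintro ⟨hA, hB, hR⟩ i
    by_cases hi0 : i = 0
    · subst hi0; simpa using hA
    by_cases hi1 : i = 1
    · subst hi1; simpa using hB
    rw [Pi.add_apply, mk2_apply_of_ne a b hi0 hi1, add_zero]
    exact hR i hi0 hi1

/-- **The two extra points of `V` do not enter a cube that the points of `U` avoid**: if the ten
points `x + u(t)` avoid `Q + c` then so do the twelve points `x + v(t)` (for `v(5) = (1,2)` and
`v(6) = (2,2)` compare with `u(2) = (0,2)` and `u(7) = (3,2)` in the first coordinate).
[cite: MadrasSlade1993, Theorem 7.3.2 (proof)] -/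
theorem not_inCube_vPt {c x : Site (d + 2)} (hU : ∀ t ≤ 9, ¬ InCube c (x + uPt t)) :
    ∀ t ≤ 11, ¬ InCube c (x + vPt t) := by
  intro t ht
  have h2 := hU 2 (by norm_num)
  have h7 := hU 7 (by norm_num)
  simp only [uPt, uCoord, inCube_add_mk2'] at h2 h7
  rcases (show t ≤ 4 ∨ t = 5 ∨ t = 6 ∨ (7 ≤ t ∧ t ≤ 11) by omega) with h | rfl | rfl | ⟨h7', h11⟩
  · have : (vPt t : Site (d + 2)) = uPt t := by interval_cases t <;> rfl
    rw [this]; exact hU t (by omega)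
  · simp only [vPt, vCoord, inCube_add_mk2']
    rintro ⟨hA, hB, hR⟩
    have h2' : ¬ (0 ≤ x 0 + 0 - c 0 ∧ x 0 + 0 - c 0 ≤ 3) := fun hA' => h2 ⟨hA', hB, hR⟩
    have h7' : ¬ (0 ≤ x 0 + 3 - c 0 ∧ x 0 + 3 - c 0 ≤ 3) := fun hA' => h7 ⟨hA', hB, hR⟩
    omega
  · simp only [vPt, vCoord, inCube_add_mk2']
    rintro ⟨hA, hB, hR⟩
    have h2' : ¬ (0 ≤ x 0 + 0 - c 0 ∧ x 0 + 0 - c 0 ≤ 3) := fun hA' => h2 ⟨hA', hB, hR⟩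
    have h7' : ¬ (0 ≤ x 0 + 3 - c 0 ∧ x 0 + 3 - c 0 ≤ 3) := fun hA' => h7 ⟨hA', hB, hR⟩
    omega
  · have : (vPt t : Site (d + 2)) = uPt (t - 2) := by interval_cases t <;> rfl
    rw [this]; exact hU (t - 2) (by omega)

/-- Every point of `U` is a point of `V`. [folklore] -/
theorem uPt_eq_vPt {t : ℕ} (ht : t ≤ 9) : ∃ t' ≤ 11, (uPt t : Site (d + 2)) = vPt t' := by
  rcases (show t ≤ 4 ∨ (5 ≤ t ∧ t ≤ 9) by omega) with h | ⟨h5, h9⟩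
  · exact ⟨t, by omega, by interval_cases t <;> rfl⟩
  · exact ⟨t + 2, by omega, by interval_cases t <;> rfl⟩

/-- An earlier occurrence of `(U, Q)` survives the transformation at `k`.
[cite: MadrasSlade1993, Theorem 7.3.2 (proof)] -/
theorem occU_insV_of_lt (hk : OccU n ω k) (hk' : OccU n ω k') (hlt : k' + 9 < k) :
    OccU (n + 2) (insV k ω) k' := by
  obtain ⟨hkn, hseg, havoid⟩ := hk
  obtain ⟨hkn', hseg', havoid'⟩ := hk'
  have hc : insV k ω k' = ω k' := insV_apply_of_le k ω (by omega)
  refine ⟨by omega, fun t ht => by rw [insV_apply_of_le k ω (by omega), hc, hseg' t ht], ?_⟩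
  intro i hi hi'
  rw [hc]
  rcases (show i ≤ k ∨ (k < i ∧ i ≤ k + 11) ∨ k + 11 < i by omega) with h | ⟨h1, h2⟩ | h
  · rw [insV_apply_of_le k ω h]
    exact havoid' i (by omega) (by omega)
  · obtain ⟨s, rfl⟩ : ∃ s, i = k + s := ⟨i - k, by omega⟩
    rw [insV_apply_window k ω (by omega)]
    refine not_inCube_vPt (fun t ht => ?_) s (by omega)
    rw [← hseg t ht]
    exact havoid' (k + t) (by omega) (Or.inr (by omega))
  · rw [insV_apply_of_gt k ω h]
    exact havoid' (i - 2) (by omega) (Or.inr (by omega))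

/-- A later occurrence of `(U, Q)` survives the transformation at `k`, shifted by `2`.
[cite: MadrasSlade1993, Theorem 7.3.2 (proof)] -/
theorem occU_insV_of_gt (hk : OccU n ω k) (hk' : OccU n ω k') (hlt : k + 9 < k') :
    OccU (n + 2) (insV k ω) (k' + 2) := by
  obtain ⟨hkn, hseg, havoid⟩ := hk
  obtain ⟨hkn', hseg', havoid'⟩ := hk'
  have hc : insV k ω (k' + 2) = ω k' := by
    rw [insV_apply_of_gt k ω (by omega), Nat.add_sub_cancel]
  refine ⟨by omega, fun t ht => ?_, ?_⟩
  · rw [hc, show k' + 2 + t = k' + t + 2 by ring, insV_apply_of_gt k ω (by omega),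
      Nat.add_sub_cancel, hseg' t ht]
  intro i hi hi'
  rw [hc]
  rcases (show i ≤ k ∨ (k < i ∧ i ≤ k + 11) ∨ k + 11 < i by omega) with h | ⟨h1, h2⟩ | h
  · rw [insV_apply_of_le k ω h]
    exact havoid' i (by omega) (Or.inl (by omega))
  · obtain ⟨s, rfl⟩ : ∃ s, i = k + s := ⟨i - k, by omega⟩
    rw [insV_apply_window k ω (by omega)]
    refine not_inCube_vPt (fun t ht => ?_) s (by omega)
    rw [← hseg t ht]
    exact havoid' (k + t) (by omega) (Or.inl (by omega))
  · rw [insV_apply_of_gt k ω h]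
    exact havoid' (i - 2) (by omega) (by omega)

/-- An earlier occurrence of `(V, Q)` survives the transformation at `k`.
[cite: MadrasSlade1993, Theorem 7.3.2 (proof)] -/
theorem occV_insV_of_lt (hk : OccU n ω k) (hk' : OccV n ω k') (hlt : k' + 11 < k) :
    OccV (n + 2) (insV k ω) k' := by
  obtain ⟨hkn, hseg, havoid⟩ := hk
  obtain ⟨hkn', hseg', havoid'⟩ := hk'
  have hc : insV k ω k' = ω k' := insV_apply_of_le k ω (by omega)
  refine ⟨by omega, fun t ht => by rw [insV_apply_of_le k ω (by omega), hc, hseg' t ht], ?_⟩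
  intro i hi hi'
  rw [hc]
  rcases (show i ≤ k ∨ (k < i ∧ i ≤ k + 11) ∨ k + 11 < i by omega) with h | ⟨h1, h2⟩ | h
  · rw [insV_apply_of_le k ω h]
    exact havoid' i (by omega) (by omega)
  · obtain ⟨s, rfl⟩ : ∃ s, i = k + s := ⟨i - k, by omega⟩
    rw [insV_apply_window k ω (by omega)]
    refine not_inCube_vPt (fun t ht => ?_) s (by omega)
    rw [← hseg t ht]
    exact havoid' (k + t) (by omega) (Or.inr (by omega))
  · rw [insV_apply_of_gt k ω h]
    exact havoid' (i - 2) (by omega) (Or.inr (by omega))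

/-- A later occurrence of `(V, Q)` survives the transformation at `k`, shifted by `2`.
[cite: MadrasSlade1993, Theorem 7.3.2 (proof)] -/
theorem occV_insV_of_gt (hk : OccU n ω k) (hk' : OccV n ω k') (hlt : k + 9 < k') :
    OccV (n + 2) (insV k ω) (k' + 2) := by
  obtain ⟨hkn, hseg, havoid⟩ := hk
  obtain ⟨hkn', hseg', havoid'⟩ := hk'
  have hc : insV k ω (k' + 2) = ω k' := by
    rw [insV_apply_of_gt k ω (by omega), Nat.add_sub_cancel]
  refine ⟨by omega, fun t ht => ?_, ?_⟩
  · rw [hc, show k' + 2 + t = k' + t + 2 by ring, insV_apply_of_gt k ω (by omega),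
      Nat.add_sub_cancel, hseg' t ht]
  intro i hi hi'
  rw [hc]
  rcases (show i ≤ k ∨ (k < i ∧ i ≤ k + 11) ∨ k + 11 < i by omega) with h | ⟨h1, h2⟩ | h
  · rw [insV_apply_of_le k ω h]
    exact havoid' i (by omega) (Or.inl (by omega))
  · obtain ⟨s, rfl⟩ : ∃ s, i = k + s := ⟨i - k, by omega⟩
    rw [insV_apply_window k ω (by omega)]
    refine not_inCube_vPt (fun t ht => ?_) s (by omega)
    rw [← hseg t ht]
    exact havoid' (k + t) (by omega) (Or.inl (by omega))
  · rw [insV_apply_of_gt k ω h]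
    exact havoid' (i - 2) (by omega) (by omega)

/-- An earlier occurrence of `(U, Q)` survives the inverse transformation at `k`.
[cite: MadrasSlade1993, Theorem 7.3.2 (proof)] -/
theorem occU_delV_of_lt (hk : OccV (n + 2) ω k) (hk' : OccU (n + 2) ω k') (hlt : k' + 9 < k) :
    OccU n (delV k ω) k' := by
  obtain ⟨hkn, hseg, havoid⟩ := hk
  obtain ⟨hkn', hseg', havoid'⟩ := hk'
  have hc : delV k ω k' = ω k' := delV_apply_of_le k ω (by omega)
  refine ⟨by omega, fun t ht => by rw [delV_apply_of_le k ω (by omega), hc, hseg' t ht], ?_⟩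
  intro i hi hi'
  rw [hc]
  rcases (show i ≤ k ∨ (k < i ∧ i ≤ k + 9) ∨ k + 9 < i by omega) with h | ⟨h1, h2⟩ | h
  · rw [delV_apply_of_le k ω h]
    exact havoid' i (by omega) (by omega)
  · obtain ⟨s, rfl⟩ : ∃ s, i = k + s := ⟨i - k, by omega⟩
    obtain ⟨t', ht', e⟩ := uPt_eq_vPt (d := d) (show s ≤ 9 by omega)
    rw [delV_apply_window k ω (by omega), e, ← hseg t' ht']
    exact havoid' (k + t') (by omega) (Or.inr (by omega))
  · rw [delV_apply_of_gt k ω h]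
    exact havoid' (i + 2) (by omega) (Or.inr (by omega))

/-- A later occurrence of `(U, Q)` survives the inverse transformation at `k`, shifted by `-2`.
[cite: MadrasSlade1993, Theorem 7.3.2 (proof)] -/
theorem occU_delV_of_gt (hk : OccV (n + 2) ω k) (hk' : OccU (n + 2) ω k') (hlt : k + 11 < k') :
    OccU n (delV k ω) (k' - 2) := by
  obtain ⟨hkn, hseg, havoid⟩ := hk
  obtain ⟨hkn', hseg', havoid'⟩ := hk'
  have hc : delV k ω (k' - 2) = ω k' := by
    rw [delV_apply_of_gt k ω (by omega), Nat.sub_add_cancel (by omega)]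
  refine ⟨by omega, fun t ht => ?_, ?_⟩
  · rw [hc, delV_apply_of_gt k ω (by omega), show k' - 2 + t + 2 = k' + t by omega, hseg' t ht]
  intro i hi hi'
  rw [hc]
  rcases (show i ≤ k ∨ (k < i ∧ i ≤ k + 9) ∨ k + 9 < i by omega) with h | ⟨h1, h2⟩ | h
  · rw [delV_apply_of_le k ω h]
    exact havoid' i (by omega) (Or.inl (by omega))
  · obtain ⟨s, rfl⟩ : ∃ s, i = k + s := ⟨i - k, by omega⟩
    obtain ⟨t', ht', e⟩ := uPt_eq_vPt (d := d) (show s ≤ 9 by omega)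
    rw [delV_apply_window k ω (by omega), e, ← hseg t' ht']
    exact havoid' (k + t') (by omega) (Or.inl (by omega))
  · rw [delV_apply_of_gt k ω h]
    exact havoid' (i + 2) (by omega) (by omega)

/-- An earlier occurrence of `(V, Q)` survives the inverse transformation at `k`.
[cite: MadrasSlade1993, Theorem 7.3.2 (proof)] -/
theorem occV_delV_of_lt (hk : OccV (n + 2) ω k) (hk' : OccV (n + 2) ω k') (hlt : k' + 11 < k) :
    OccV n (delV k ω) k' := by
  obtain ⟨hkn, hseg, havoid⟩ := hk
  obtain ⟨hkn', hseg', havoid'⟩ := hk'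
  have hc : delV k ω k' = ω k' := delV_apply_of_le k ω (by omega)
  refine ⟨by omega, fun t ht => by rw [delV_apply_of_le k ω (by omega), hc, hseg' t ht], ?_⟩
  intro i hi hi'
  rw [hc]
  rcases (show i ≤ k ∨ (k < i ∧ i ≤ k + 9) ∨ k + 9 < i by omega) with h | ⟨h1, h2⟩ | h
  · rw [delV_apply_of_le k ω h]
    exact havoid' i (by omega) (by omega)
  · obtain ⟨s, rfl⟩ : ∃ s, i = k + s := ⟨i - k, by omega⟩
    obtain ⟨t', ht', e⟩ := uPt_eq_vPt (d := d) (show s ≤ 9 by omega)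
    rw [delV_apply_window k ω (by omega), e, ← hseg t' ht']
    exact havoid' (k + t') (by omega) (Or.inr (by omega))
  · rw [delV_apply_of_gt k ω h]
    exact havoid' (i + 2) (by omega) (Or.inr (by omega))

/-- A later occurrence of `(V, Q)` survives the inverse transformation at `k`, shifted by `-2`.
[cite: MadrasSlade1993, Theorem 7.3.2 (proof)] -/
theorem occV_delV_of_gt (hk : OccV (n + 2) ω k) (hk' : OccV (n + 2) ω k') (hlt : k + 11 < k') :
    OccV n (delV k ω) (k' - 2) := by
  obtain ⟨hkn, hseg, havoid⟩ := hk
  obtain ⟨hkn', hseg', havoid'⟩ := hk'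
  have hc : delV k ω (k' - 2) = ω k' := by
    rw [delV_apply_of_gt k ω (by omega), Nat.sub_add_cancel (by omega)]
  refine ⟨by omega, fun t ht => ?_, ?_⟩
  · rw [hc, delV_apply_of_gt k ω (by omega), show k' - 2 + t + 2 = k' + t by omega, hseg' t ht]
  intro i hi hi'
  rw [hc]
  rcases (show i ≤ k ∨ (k < i ∧ i ≤ k + 9) ∨ k + 9 < i by omega) with h | ⟨h1, h2⟩ | h
  · rw [delV_apply_of_le k ω h]
    exact havoid' i (by omega) (Or.inl (by omega))
  · obtain ⟨s, rfl⟩ : ∃ s, i = k + s := ⟨i - k, by omega⟩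
    obtain ⟨t', ht', e⟩ := uPt_eq_vPt (d := d) (show s ≤ 9 by omega)
    rw [delV_apply_window k ω (by omega), e, ← hseg t' ht']
    exact havoid' (k + t') (by omega) (Or.inl (by omega))
  · rw [delV_apply_of_gt k ω h]
    exact havoid' (i + 2) (by omega) (by omega)

end Preserve

/-! #### Counting occurrences: `I(ω) = #(U,Q)`-occurrences, `J(ω) = #(V,Q)`-occurrences -/

section Counting

open scoped Classical

variable {n k : ℕ} {ω : ℕ → Site (d + 2)}

/-- The steps at which `(U, Q)` occurs on the `n`-step walk `ω`. [cite: MadrasSlade1993, Theorem 7.3.2 (proof)] -/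
def uSites (n : ℕ) (ω : ℕ → Site (d + 2)) : Finset ℕ := (Finset.range (n + 1)).filter (OccU n ω)

/-- The steps at which `(V, Q)` occurs on the `n`-step walk `ω`. [cite: MadrasSlade1993, Theorem 7.3.2 (proof)] -/
def vSites (n : ℕ) (ω : ℕ → Site (d + 2)) : Finset ℕ := (Finset.range (n + 1)).filter (OccV n ω)

/-- `i = I(ω)`, the number of occurrences of `(U, Q)` on `ω` ("`(U,Q)` occurs at precisely `i`
different steps"). [cite: MadrasSlade1993, Theorem 7.3.2 (proof)] -/
def uCount (n : ℕ) (ω : ℕ → Site (d + 2)) : ℕ := (uSites n ω).card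

/-- `j = J(ω)`, the number of occurrences of `(V, Q)` on `ω`. [cite: MadrasSlade1993, Theorem 7.3.2 (proof)] -/
def vCount (n : ℕ) (ω : ℕ → Site (d + 2)) : ℕ := (vSites n ω).card

/-- Membership in `uSites`. [folklore] -/
theorem mem_uSites : k ∈ uSites n ω ↔ OccU n ω k := by
  unfold uSites
  rw [Finset.mem_filter, Finset.mem_range]
  exact ⟨fun h => h.2, fun h => ⟨by have := h.1; omega, h⟩⟩

/-- Membership in `vSites`. [folklore] -/
theorem mem_vSites : k ∈ vSites n ω ↔ OccV n ω k := by
  unfold vSites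
  rw [Finset.mem_filter, Finset.mem_range]
  exact ⟨fun h => h.2, fun h => ⟨by have := h.1; omega, h⟩⟩

/-- `I(ω) ≤ n + 1`. [folklore] -/
theorem uCount_le : uCount n ω ≤ n + 1 := by
  unfold uCount uSites
  exact (Finset.card_filter_le _ _).trans (by simp)

/-- `J(ω) ≤ n + 1`. [folklore] -/
theorem vCount_le : vCount n ω ≤ n + 1 := by
  unfold vCount vSites
  exact (Finset.card_filter_le _ _).trans (by simp)

/-- The re-indexing of steps under the transformation at `k`: steps before `k` are kept, later
steps are shifted by `2`. [folklore] -/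
def shift2 (k k' : ℕ) : ℕ := if k' < k then k' else k' + 2

/-- `shift2 k` is injective. [folklore] -/
theorem shift2_injective (k : ℕ) : Function.Injective (shift2 k) := by
  intro a b h
  unfold shift2 at h
  split_ifs at h <;> omega

/-- `shift2 k` never takes the value `k`. [folklore] -/
theorem shift2_ne_self {k k' : ℕ} : shift2 k k' ≠ k := by
  unfold shift2; split_ifs <;> omega

/-- **The transformation at `k` removes the occurrence of `(U,Q)` at `k` and keeps all others**
(re-indexed). [cite: MadrasSlade1993, Theorem 7.3.2 (proof)] -/
theorem uSites_insV (hk : OccU n ω k) :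
    uSites (n + 2) (insV k ω) = ((uSites n ω).erase k).image (shift2 k) := by
  ext k''
  simp only [mem_uSites, Finset.mem_image, Finset.mem_erase]
  have hV := occV_insV hk
  constructor
  · intro h
    rcases occU_sep_occV h hV with h1 | h1
    · refine ⟨k'', ⟨by omega, ?_⟩, by simp [shift2, show k'' < k by omega]⟩
      have := occU_delV_of_lt hV h h1
      rwa [delV_insV hk] at this
    · refine ⟨k'' - 2, ⟨by omega, ?_⟩, by simp [shift2, show ¬ (k'' - 2 < k) by omega]; omega⟩
      have := occU_delV_of_gt hV h h1
      rwa [delV_insV hk] at this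
  · rintro ⟨k', ⟨hne, hk'⟩, rfl⟩
    rcases occU_sep_occU hk hk' (Ne.symm hne) with h1 | h1
    · rw [show shift2 k k' = k' + 2 by simp [shift2, show ¬ (k' < k) by omega]]
      exact occU_insV_of_gt hk hk' h1
    · rw [show shift2 k k' = k' by simp [shift2, show k' < k by omega]]
      exact occU_insV_of_lt hk hk' h1

/-- **The transformation at `k` creates the occurrence of `(V,Q)` at `k` and keeps all others**
(re-indexed). [cite: MadrasSlade1993, Theorem 7.3.2 (proof)] -/
theorem vSites_insV (hk : OccU n ω k) :
    vSites (n + 2) (insV k ω) = insert k ((vSites n ω).image (shift2 k)) := by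
  ext k''
  simp only [mem_vSites, Finset.mem_insert, Finset.mem_image]
  have hV := occV_insV hk
  constructor
  · intro h
    by_cases hkk : k'' = k
    · exact Or.inl hkk
    right
    rcases occV_sep_occV hV h (Ne.symm hkk) with h1 | h1
    · refine ⟨k'' - 2, ?_, by simp [shift2, show ¬ (k'' - 2 < k) by omega]; omega⟩
      have := occV_delV_of_gt hV h h1
      rwa [delV_insV hk] at this
    · refine ⟨k'', ?_, by simp [shift2, show k'' < k by omega]⟩
      have := occV_delV_of_lt hV h h1
      rwa [delV_insV hk] at this
  · rintro (rfl | ⟨k', hk', rfl⟩)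
    · exact hV
    · rcases occU_sep_occV hk hk' with h1 | h1
      · rw [show shift2 k k' = k' + 2 by simp [shift2, show ¬ (k' < k) by omega]]
        exact occV_insV_of_gt hk hk' h1
      · rw [show shift2 k k' = k' by simp [shift2, show k' < k by omega]]
        exact occV_insV_of_lt hk hk' h1

/-- `I(ω') = I(ω) - 1` ("`ω' ∈ W_{N+2}(i-1, j+1)`"). [cite: MadrasSlade1993, Theorem 7.3.2 (proof)] -/
theorem uCount_insV (hk : OccU n ω k) : uCount (n + 2) (insV k ω) + 1 = uCount n ω := by
  unfold uCount
  rw [uSites_insV hk, Finset.card_image_of_injective _ (shift2_injective k),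
    Finset.card_erase_of_mem (mem_uSites.2 hk)]
  exact Nat.sub_add_cancel (Finset.card_pos.2 ⟨k, mem_uSites.2 hk⟩)

/-- `J(ω') = J(ω) + 1` ("`ω' ∈ W_{N+2}(i-1, j+1)`"). [cite: MadrasSlade1993, Theorem 7.3.2 (proof)] -/
theorem vCount_insV (hk : OccU n ω k) : vCount (n + 2) (insV k ω) = vCount n ω + 1 := by
  unfold vCount
  rw [vSites_insV hk, Finset.card_insert_of_notMem, Finset.card_image_of_injective _ (shift2_injective k)]
  intro h
  obtain ⟨k', -, e⟩ := Finset.mem_image.1 h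
  exact shift2_ne_self e

/-! #### Counting the allowed pairs in two ways -/

/-- The allowed pairs `(ω, k)`: `ω ∈ S_n` and `(U, Q)` occurs at the `k`-th step of `ω`.
[cite: MadrasSlade1993, Theorem 7.3.2 (proof)] -/
def uPairs (n : ℕ) : Finset ((ℕ → Site (d + 2)) × ℕ) :=
  (saws (d + 2) n ×ˢ Finset.range (n + 1)).filter fun p => OccU n p.1 p.2

/-- The pairs `(ω', k)`: `ω' ∈ S_n` and `(V, Q)` occurs at the `k`-th step of `ω'`.
[cite: MadrasSlade1993, Theorem 7.3.2 (proof)] -/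
def vPairs (n : ℕ) : Finset ((ℕ → Site (d + 2)) × ℕ) :=
  (saws (d + 2) n ×ˢ Finset.range (n + 1)).filter fun p => OccV n p.1 p.2

/-- Membership in `uPairs`. [folklore] -/
theorem mem_uPairs {p : (ℕ → Site (d + 2)) × ℕ} :
    p ∈ uPairs n ↔ p.1 ∈ saws (d + 2) n ∧ OccU n p.1 p.2 := by
  unfold uPairs
  rw [Finset.mem_filter, Finset.mem_product, Finset.mem_range]
  exact ⟨fun h => ⟨h.1.1, h.2⟩, fun h => ⟨⟨h.1, by have := h.2.1; omega⟩, h.2⟩⟩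

/-- Membership in `vPairs`. [folklore] -/
theorem mem_vPairs {p : (ℕ → Site (d + 2)) × ℕ} :
    p ∈ vPairs n ↔ p.1 ∈ saws (d + 2) n ∧ OccV n p.1 p.2 := by
  unfold vPairs
  rw [Finset.mem_filter, Finset.mem_product, Finset.mem_range]
  exact ⟨fun h => ⟨h.1.1, h.2⟩, fun h => ⟨⟨h.1, by have := h.2.1; omega⟩, h.2⟩⟩

/-- Summing over allowed pairs is summing `I(ω) · F(ω)` over walks. [folklore] -/
theorem sum_uPairs (F : (ℕ → Site (d + 2)) → ℝ) :
    ∑ p ∈ uPairs (d := d) n, F p.1 = ∑ ω ∈ saws (d + 2) n, (uCount n ω : ℝ) * F ω := by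
  classical
  unfold uPairs
  rw [Finset.sum_filter, Finset.sum_product]
  refine Finset.sum_congr rfl fun ω _ => ?_
  rw [Finset.sum_ite, Finset.sum_const_zero, add_zero]
  dsimp only
  rw [Finset.sum_const, nsmul_eq_mul]
  rfl

/-- Summing over `V`-pairs is summing `J(ω) · F(ω)` over walks. [folklore] -/
theorem sum_vPairs (F : (ℕ → Site (d + 2)) → ℝ) :
    ∑ p ∈ vPairs (d := d) n, F p.1 = ∑ ω ∈ saws (d + 2) n, (vCount n ω : ℝ) * F ω := by
  classical
  unfold vPairs
  rw [Finset.sum_filter, Finset.sum_product]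
  refine Finset.sum_congr rfl fun ω _ => ?_
  rw [Finset.sum_ite, Finset.sum_const_zero, add_zero]
  dsimp only
  rw [Finset.sum_const, nsmul_eq_mul]
  rfl

/-- **"Counting the number of allowed pairs in two ways"**: the transformation
`(ω, k) ↦ (ω', k)` is a bijection from the allowed pairs of `S_n` onto the `V`-pairs of
`S_{n+2}`. [cite: MadrasSlade1993, Theorem 7.3.2 (proof), eq. (7.3.6)] -/
theorem sum_uPairs_eq_sum_vPairs (F G : (ℕ → Site (d + 2)) × ℕ → ℝ)
    (h : ∀ p ∈ uPairs (d := d) n, F p = G (insV p.2 p.1, p.2)) :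
    ∑ p ∈ uPairs (d := d) n, F p = ∑ q ∈ vPairs (d := d) (n + 2), G q := by
  refine Finset.sum_nbij' (fun p => (insV p.2 p.1, p.2)) (fun q => (delV q.2 q.1, q.2)) ?_ ?_ ?_ ?_ h
  · intro p hp
    obtain ⟨hω, hk⟩ := mem_uPairs.1 hp
    exact mem_vPairs.2 ⟨insV_mem_saws hω hk, occV_insV hk⟩
  · intro q hq
    obtain ⟨hω, hk⟩ := mem_vPairs.1 hq
    exact mem_uPairs.2 ⟨delV_mem_saws hω hk, occU_delV hk⟩
  · intro p hp
    obtain ⟨-, hk⟩ := mem_uPairs.1 hp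
    simp only [delV_insV hk]
  · intro q hq
    obtain ⟨-, hk⟩ := mem_vPairs.1 hq
    simp only [insV_delV hk]

/-- **(7.3.6)**: `Σ_{i ≥ 1, j ≥ 0} (i/(j+1)) w_N(i,j) = w_{N+2}(≥ 0, ≥ 1)`, i.e.
`Σ_{ω ∈ S_N} I(ω)/(J(ω)+1)` is the number of `(N+2)`-step walks with at least one occurrence of
`(V, Q)`. [cite: MadrasSlade1993, Theorem 7.3.2 (proof), eq. (7.3.6)] -/
theorem sum_ratio_eq_card (n : ℕ) :
    ∑ ω ∈ saws (d + 2) n, (uCount n ω : ℝ) / (vCount n ω + 1) =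
      (((saws (d + 2) (n + 2)).filter fun ω => 1 ≤ vCount (n + 2) ω).card : ℝ) := by
  have h1 : ∑ ω ∈ saws (d + 2) n, (uCount n ω : ℝ) / (vCount n ω + 1) =
      ∑ p ∈ uPairs (d := d) n, 1 / ((vCount n p.1 : ℝ) + 1) := by
    rw [sum_uPairs (F := fun ω => 1 / ((vCount n ω : ℝ) + 1))]
    refine Finset.sum_congr rfl fun ω _ => ?_
    rw [mul_one_div]
  have h2 : ∑ p ∈ uPairs (d := d) n, 1 / ((vCount n p.1 : ℝ) + 1) =
      ∑ q ∈ vPairs (d := d) (n + 2), 1 / (vCount (n + 2) q.1 : ℝ) := by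
    refine sum_uPairs_eq_sum_vPairs _ (fun q => 1 / (vCount (n + 2) q.1 : ℝ)) fun p hp => ?_
    obtain ⟨-, hk⟩ := mem_uPairs.1 hp
    simp only [vCount_insV hk, Nat.cast_succ]
  have h3 : ∑ q ∈ vPairs (d := d) (n + 2), 1 / (vCount (n + 2) q.1 : ℝ) =
      ∑ ω ∈ saws (d + 2) (n + 2), (vCount (n + 2) ω : ℝ) * (1 / (vCount (n + 2) ω : ℝ)) :=
    sum_vPairs (n := n + 2) (F := fun ω => 1 / (vCount (n + 2) ω : ℝ))
  rw [h1, h2, h3, Finset.card_eq_sum_ones, Nat.cast_sum, Finset.sum_filter]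
  refine Finset.sum_congr rfl fun ω _ => ?_
  by_cases h : 1 ≤ vCount (n + 2) ω
  · rw [if_pos h, mul_one_div_cancel]
    · simp
    · exact_mod_cast (show vCount (n + 2) ω ≠ 0 by omega)
  · rw [if_neg h, show vCount (n + 2) ω = 0 by omega]
    simp

/-- **(7.3.7), weak form**: `Σ_{ω ∈ S_N} I(I-1)/((J+1)(J+2)) ≤ Σ_{ω' ∈ S_{N+2}} I/(J+1)` (the
left side counts the `(N+4)`-step walks with `J ≥ 2`, the right side those with `J ≥ 1`).
[cite: MadrasSlade1993, Theorem 7.3.2 (proof), eq. (7.3.7)] -/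
theorem sum_ratio₂_le (n : ℕ) :
    ∑ ω ∈ saws (d + 2) n,
        (uCount n ω : ℝ) * ((uCount n ω : ℝ) - 1) / (((vCount n ω : ℝ) + 1) * ((vCount n ω : ℝ) + 2)) ≤
      ∑ ω ∈ saws (d + 2) (n + 2), (uCount (n + 2) ω : ℝ) / (vCount (n + 2) ω + 1) := by
  have h1 : ∑ ω ∈ saws (d + 2) n,
      (uCount n ω : ℝ) * ((uCount n ω : ℝ) - 1) / (((vCount n ω : ℝ) + 1) * ((vCount n ω : ℝ) + 2)) =
      ∑ p ∈ uPairs (d := d) n,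
        ((uCount n p.1 : ℝ) - 1) / (((vCount n p.1 : ℝ) + 1) * ((vCount n p.1 : ℝ) + 2)) := by
    rw [sum_uPairs (F := fun ω =>
      ((uCount n ω : ℝ) - 1) / (((vCount n ω : ℝ) + 1) * ((vCount n ω : ℝ) + 2)))]
    refine Finset.sum_congr rfl fun ω _ => ?_
    rw [mul_div_assoc]
  have h2 : ∑ p ∈ uPairs (d := d) n,
        ((uCount n p.1 : ℝ) - 1) / (((vCount n p.1 : ℝ) + 1) * ((vCount n p.1 : ℝ) + 2)) =
      ∑ q ∈ vPairs (d := d) (n + 2),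
        (uCount (n + 2) q.1 : ℝ) / ((vCount (n + 2) q.1 : ℝ) * ((vCount (n + 2) q.1 : ℝ) + 1)) := by
    refine sum_uPairs_eq_sum_vPairs _
      (fun q => (uCount (n + 2) q.1 : ℝ) / ((vCount (n + 2) q.1 : ℝ) * ((vCount (n + 2) q.1 : ℝ) + 1)))
      fun p hp => ?_
    obtain ⟨-, hk⟩ := mem_uPairs.1 hp
    have hu : (uCount n p.1 : ℝ) - 1 = uCount (n + 2) (insV p.2 p.1) := by
      rw [← uCount_insV hk]; push_cast; ring
    simp only [hu, vCount_insV hk, Nat.cast_succ]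
    ring_nf
  have h3 : ∑ q ∈ vPairs (d := d) (n + 2),
        (uCount (n + 2) q.1 : ℝ) / ((vCount (n + 2) q.1 : ℝ) * ((vCount (n + 2) q.1 : ℝ) + 1)) =
      ∑ ω ∈ saws (d + 2) (n + 2), (vCount (n + 2) ω : ℝ) *
        ((uCount (n + 2) ω : ℝ) / ((vCount (n + 2) ω : ℝ) * ((vCount (n + 2) ω : ℝ) + 1))) :=
    sum_vPairs (n := n + 2) (F := fun ω =>
      (uCount (n + 2) ω : ℝ) / ((vCount (n + 2) ω : ℝ) * ((vCount (n + 2) ω : ℝ) + 1)))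
  rw [h1, h2, h3]
  refine Finset.sum_le_sum fun ω _ => ?_
  by_cases h : vCount (n + 2) ω = 0
  · rw [h]; simp
  · have hpos : (0 : ℝ) < vCount (n + 2) ω := by exact_mod_cast Nat.pos_of_ne_zero h
    rw [le_div_iff₀ (by positivity)]
    field_simp
    exact le_rfl

end Counting

/-! #### Theorem 7.3.2(a) from the pattern theorem for `(V, Q)` -/

section Theorem732

/-- The summand of `Ξ_N` (7.3.10): `I²/(J+1)² - I(I-1)/((J+1)(J+2)) = I(I+J+1)/((J+1)²(J+2))`
is `O(1/N)` when `J ≥ aN` and `O(N²)` always (`I, J ≤ N + 1`).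
[cite: MadrasSlade1993, Theorem 7.3.2 (proof)] -/
theorem xi_term_le {a I J : ℝ} {N : ℕ} (ha : 0 < a) (hN : 1 ≤ N) (hI0 : 0 ≤ I)
    (hIle : I ≤ 2 * N) (hJ0 : 0 ≤ J) (hJle : J ≤ 2 * N) :
    (I / (J + 1)) ^ 2 - I * (I - 1) / ((J + 1) * (J + 2)) ≤
      (4 / a ^ 3 + 2 / a ^ 2) / N + 10 * (N : ℝ) ^ 2 * (if J < a * N then 1 else 0) := by
  have hN0 : (0 : ℝ) < N := by exact_mod_cast hN
  have hN1 : (1 : ℝ) ≤ N := by exact_mod_cast hN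
  obtain ⟨x, hx⟩ : ∃ x : ℝ, x = J + 1 := ⟨_, rfl⟩
  have hx0 : 0 < x := by rw [hx]; positivity
  have hx1 : 1 ≤ x := by rw [hx]; linarith
  have hform : (I / (J + 1)) ^ 2 - I * (I - 1) / ((J + 1) * (J + 2)) =
      I * (I + x) / (x ^ 2 * (x + 1)) := by
    rw [show J + 2 = x + 1 by rw [hx]; ring, ← hx]
    field_simp
    ring
  rw [hform]
  have h1 : I * (I + x) / (x ^ 2 * (x + 1)) ≤ I * (I + x) / x ^ 3 :=
    div_le_div_of_nonneg_left (by positivity) (by positivity) (by nlinarith)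
  have hK0 : 0 ≤ (4 / a ^ 3 + 2 / a ^ 2) / N := by positivity
  by_cases hlt : J < a * N
  · rw [if_pos hlt, mul_one]
    have h2 : I * (I + x) / x ^ 3 ≤ I * (I + x) := div_le_self (by positivity) (one_le_pow₀ hx1)
    have hxle : x ≤ 2 * N + 1 := by rw [hx]; linarith
    have h3 : I * (I + x) ≤ 10 * (N : ℝ) ^ 2 := by nlinarith
    linarith
  · rw [if_neg hlt, mul_zero, add_zero]
    push Not at hlt
    have hxge : a * N ≤ x := by rw [hx]; linarith
    have haN : 0 < a * N := by positivity
    have h2 : I * (I + x) / x ^ 3 = I ^ 2 / x ^ 3 + I / x ^ 2 := by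
      field_simp
    have h3 : I ^ 2 / x ^ 3 ≤ (2 * N) ^ 2 / (a * N) ^ 3 :=
      div_le_div₀ (by positivity) (pow_le_pow_left₀ hI0 hIle 2) (by positivity)
        (pow_le_pow_left₀ haN.le hxge 3)
    have h4 : I / x ^ 2 ≤ (2 * N) / (a * N) ^ 2 :=
      div_le_div₀ (by positivity) hIle (by positivity) (pow_le_pow_left₀ haN.le hxge 2)
    have h5 : (2 * (N : ℝ)) ^ 2 / (a * N) ^ 3 + 2 * N / (a * N) ^ 2 = (4 / a ^ 3 + 2 / a ^ 2) / N := by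
      field_simp
      ring
    linarith

/-- The bound on `Ξ_N` (7.3.10): `Σ_ω [I²/(J+1)² - I(I-1)/((J+1)(J+2))] ≤ c_N (K + 10C)/N` when at
most `C c_N/N³` walks have `J < aN` (`K = 4/a³ + 2/a²`). [cite: MadrasSlade1993, Theorem 7.3.2 (proof)] -/
theorem sum_xi_le {a C : ℝ} (ha : 0 < a) {N : ℕ} (hN : 1 ≤ N)
    (hPTN : ((((saws (d + 2) N).filter fun ω => (vCount N ω : ℝ) < a * N).card : ℝ)) ≤
      C * count (d + 2) N / (N : ℝ) ^ 3) :
    ∑ ω ∈ saws (d + 2) N, ((uCount N ω : ℝ) / ((vCount N ω : ℝ) + 1)) ^ 2 -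
      ∑ ω ∈ saws (d + 2) N, (uCount N ω : ℝ) * ((uCount N ω : ℝ) - 1) /
        (((vCount N ω : ℝ) + 1) * ((vCount N ω : ℝ) + 2)) ≤
      count (d + 2) N * ((4 / a ^ 3 + 2 / a ^ 2 + 10 * C) / N) := by
  have hN0 : (0 : ℝ) < N := by exact_mod_cast hN
  have hN1 : (1 : ℝ) ≤ N := by exact_mod_cast hN
  rw [← Finset.sum_sub_distrib]
  have key : ∀ ω ∈ saws (d + 2) N,
      ((uCount N ω : ℝ) / ((vCount N ω : ℝ) + 1)) ^ 2 -
        (uCount N ω : ℝ) * ((uCount N ω : ℝ) - 1) / (((vCount N ω : ℝ) + 1) * ((vCount N ω : ℝ) + 2)) ≤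
      (4 / a ^ 3 + 2 / a ^ 2) / N + 10 * (N : ℝ) ^ 2 * (if (vCount N ω : ℝ) < a * N then 1 else 0) := by
    intro ω _
    refine xi_term_le ha hN (Nat.cast_nonneg _) ?_ (Nat.cast_nonneg _) ?_
    · have : (uCount N ω : ℝ) ≤ N + 1 := by exact_mod_cast uCount_le
      linarith
    · have : (vCount N ω : ℝ) ≤ N + 1 := by exact_mod_cast vCount_le
      linarith
  refine (Finset.sum_le_sum key).trans ?_
  rw [Finset.sum_add_distrib, Finset.sum_const, card_saws, nsmul_eq_mul, ← Finset.mul_sum,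
    Finset.sum_boole]
  have h1 : 10 * (N : ℝ) ^ 2 *
      ((((saws (d + 2) N).filter fun ω => (vCount N ω : ℝ) < a * N).card : ℝ)) ≤
      10 * (N : ℝ) ^ 2 * (C * count (d + 2) N / N ^ 3) :=
    mul_le_mul_of_nonneg_left hPTN (by positivity)
  have e : 10 * (N : ℝ) ^ 2 * (C * count (d + 2) N / N ^ 3) = count (d + 2) N * (10 * C / N) := by
    field_simp
  have e2 : (count (d + 2) N : ℝ) * ((4 / a ^ 3 + 2 / a ^ 2) / N) + count (d + 2) N * (10 * C / N) =
      count (d + 2) N * ((4 / a ^ 3 + 2 / a ^ 2 + 10 * C) / N) := by ring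
  linarith

/-- The bound on `S_N` (7.3.11): the `(N+2)`-step walks without occurrence of `(V, Q)` number at
most `C c_{N+2}/N³`. [cite: MadrasSlade1993, Theorem 7.3.2 (proof)] -/
theorem card_vCount_zero_le {a C : ℝ} (ha : 0 < a) (hC0 : 0 ≤ C) {N : ℕ} (hN : 1 ≤ N)
    (hPTN2 : ((((saws (d + 2) (N + 2)).filter
        fun ω => (vCount (N + 2) ω : ℝ) < a * ((N + 2 : ℕ) : ℝ)).card : ℝ)) ≤
      C * count (d + 2) (N + 2) / (((N + 2 : ℕ) : ℝ)) ^ 3) :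
    ((((saws (d + 2) (N + 2)).filter fun ω => ¬ 1 ≤ vCount (N + 2) ω).card : ℝ)) ≤
      C * count (d + 2) (N + 2) / (N : ℝ) ^ 3 := by
  have hN0 : (0 : ℝ) < N := by exact_mod_cast hN
  have h1 : ((saws (d + 2) (N + 2)).filter fun ω => ¬ 1 ≤ vCount (N + 2) ω).card ≤
      ((saws (d + 2) (N + 2)).filter
        fun ω => (vCount (N + 2) ω : ℝ) < a * ((N + 2 : ℕ) : ℝ)).card := by
    refine Finset.card_le_card fun ω => ?_
    simp only [Finset.mem_filter, not_le, Nat.lt_one_iff]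
    rintro ⟨hω, hv⟩
    refine ⟨hω, ?_⟩
    rw [hv, Nat.cast_zero]
    positivity
  have h3 : C * count (d + 2) (N + 2) / ((N + 2 : ℕ) : ℝ) ^ 3 ≤ C * count (d + 2) (N + 2) / N ^ 3 := by
    refine div_le_div_of_nonneg_left (by positivity) (by positivity) ?_
    exact pow_le_pow_left₀ hN0.le (by push_cast; linarith) 3
  calc ((((saws (d + 2) (N + 2)).filter fun ω => ¬ 1 ≤ vCount (N + 2) ω).card : ℝ))
      ≤ _ := by exact_mod_cast h1
    _ ≤ _ := hPTN2
    _ ≤ _ := h3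

/-- **Madras–Slade Theorem 7.3.2(a) from Kesten's Pattern Theorem for `(V, Q)`.** Suppose that
for some `a > 0` and `C` the `N`-step self-avoiding walks on `ℤ^{d+2}` with fewer than `aN`
occurrences of `(V, Q)` number at most `C c_N / N³` for every `N ≥ 1` (Kesten's Pattern
Theorem 7.2.3(a) gives the stronger exponential bound (7.3.12)). Then there is a constant `D`
with `φ_N φ_{N+2} ≥ φ_N² - D/N` for all large `N`, `φ_N = c_{N+2}/c_N` (7.3.4). Proof as printed:
with `A = Σ_ω I/(J+1) = w_{N+2}(≥0,≥1)` (7.3.6), `B = Σ_ω I(I-1)/((J+1)(J+2)) ≤ c_{N+4}` (7.3.7),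
Schwarz `A² ≤ c_N Σ_ω I²/(J+1)²` (7.3.8)–(7.3.9), the error `c_{N+2} - A = #{J = 0}` (the term
`S_N` of (7.3.11)) and `Σ_ω [I²/(J+1)² - I(I-1)/((J+1)(J+2))]` (the term `Ξ_N`, (7.3.10)), both
controlled by splitting according to `J ≥ aN`. [cite: MadrasSlade1993, Theorem 7.3.2(a) (proof)] -/
theorem thm732_of_patternBound (d : ℕ) {a C : ℝ} (ha : 0 < a)
    (hPT : ∀ n : ℕ, 1 ≤ n →
      ((((saws (d + 2) n).filter fun ω => (vCount n ω : ℝ) < a * n).card : ℝ)) ≤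
        C * count (d + 2) n / (n : ℝ) ^ 3) :
    ∃ D : ℝ, ∀ᶠ N : ℕ in atTop,
      ((count (d + 2) (N + 2) : ℝ) / count (d + 2) N) ^ 2 - D / N ≤
        ((count (d + 2) (N + 2) : ℝ) / count (d + 2) N) *
          ((count (d + 2) (N + 4) : ℝ) / count (d + 2) (N + 2)) := by
  have hcpos : ∀ m, (0 : ℝ) < count (d + 2) m := fun m => by exact_mod_cast one_le_count (d + 2) m
  have hC0 : 0 ≤ C := by
    have h := hPT 1 le_rfl
    rw [Nat.cast_one, one_pow, div_one] at h
    exact nonneg_of_mul_nonneg_left ((Nat.cast_nonneg _).trans h) (hcpos 1)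
  obtain ⟨c₂, hc₂⟩ : ∃ c₂ : ℝ, c₂ = count (d + 2) 2 := ⟨_, rfl⟩
  obtain ⟨K, hK⟩ : ∃ K : ℝ, K = 4 / a ^ 3 + 2 / a ^ 2 := ⟨_, rfl⟩
  have hK0 : 0 ≤ K := by rw [hK]; positivity
  refine ⟨K + 10 * C + 3 * C * c₂ ^ 2, ?_⟩
  filter_upwards [eventually_ge_atTop 1] with N hN
  have hN0 : (0 : ℝ) < N := by exact_mod_cast hN
  have hN1 : (1 : ℝ) ≤ N := by exact_mod_cast hN
  obtain ⟨cN, hcN_def⟩ : ∃ x : ℝ, x = count (d + 2) N := ⟨_, rfl⟩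
  obtain ⟨cN2, hcN2_def⟩ : ∃ x : ℝ, x = count (d + 2) (N + 2) := ⟨_, rfl⟩
  obtain ⟨cN4, hcN4_def⟩ : ∃ x : ℝ, x = count (d + 2) (N + 4) := ⟨_, rfl⟩
  have hcN : 0 < cN := hcN_def ▸ hcpos N
  have hcN2 : 0 < cN2 := hcN2_def ▸ hcpos (N + 2)
  obtain ⟨A, hA⟩ : ∃ x : ℝ, x = ∑ ω ∈ saws (d + 2) N, (uCount N ω : ℝ) / (vCount N ω + 1) := ⟨_, rfl⟩
  obtain ⟨Cq, hCq⟩ : ∃ x : ℝ,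
      x = ∑ ω ∈ saws (d + 2) N, ((uCount N ω : ℝ) / ((vCount N ω : ℝ) + 1)) ^ 2 := ⟨_, rfl⟩
  obtain ⟨B, hB⟩ : ∃ x : ℝ, x = ∑ ω ∈ saws (d + 2) N,
      (uCount N ω : ℝ) * ((uCount N ω : ℝ) - 1) / (((vCount N ω : ℝ) + 1) * ((vCount N ω : ℝ) + 2)) :=
    ⟨_, rfl⟩
  obtain ⟨W₁, hW₁⟩ : ∃ x : ℕ, x = ((saws (d + 2) (N + 2)).filter fun ω => 1 ≤ vCount (N + 2) ω).card :=
    ⟨_, rfl⟩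
  obtain ⟨Z, hZ⟩ : ∃ x : ℕ, x = ((saws (d + 2) (N + 2)).filter fun ω => ¬ 1 ≤ vCount (N + 2) ω).card :=
    ⟨_, rfl⟩
  -- (a) `A = w_{N+2}(≥ 0, ≥ 1)` (7.3.6)
  have ha' : A = W₁ := by rw [hA, hW₁]; exact sum_ratio_eq_card N
  -- (b) `c_{N+2} = w_{N+2}(≥0,≥1) + #{J = 0}`
  have hb : cN2 = W₁ + Z := by
    have h := Finset.card_filter_add_card_filter_not (s := saws (d + 2) (N + 2))
      (fun ω => 1 ≤ vCount (N + 2) ω)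
    rw [card_saws] at h
    rw [hcN2_def, ← h, Nat.cast_add, hW₁, hZ]
  -- (c) `B ≤ c_{N+4}` (7.3.7)
  have hc : B ≤ cN4 := by
    rw [hB, hcN4_def]
    refine (sum_ratio₂_le N).trans ?_
    rw [sum_ratio_eq_card (N + 2)]
    exact_mod_cast (Finset.card_filter_le _ _).trans (card_saws (d + 2) (N + 4)).le
  -- (d) Schwarz (7.3.8): `A² ≤ c_N · Σ (I/(J+1))²`
  have hd : A ^ 2 ≤ cN * Cq := by
    have h := sq_sum_le_card_mul_sum_sq (s := saws (d + 2) N)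
      (f := fun ω => (uCount N ω : ℝ) / ((vCount N ω : ℝ) + 1))
    rw [card_saws] at h
    rw [hA, hcN_def, hCq]
    exact h
  -- (e) the term `Ξ_N`
  have he : Cq - B ≤ cN * ((K + 10 * C) / N) := by
    rw [hCq, hB, hcN_def, hK]
    exact sum_xi_le ha hN (hPT N hN)
  -- (f) the term `S_N`
  have hf : (Z : ℝ) ≤ C * cN2 / N ^ 3 := by
    rw [hZ, hcN2_def]
    exact card_vCount_zero_le ha hC0 hN (hPT (N + 2) (by omega))
  -- (g) `c_{N+2} ≤ c_N c_2`
  have hg : cN2 ≤ cN * c₂ := by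
    rw [hcN2_def, hcN_def, hc₂]; exact_mod_cast count_add_le (d + 2) N 2
  ---- assembling
  have hφ : ((count (d + 2) (N + 2) : ℝ) / count (d + 2) N) *
      ((count (d + 2) (N + 4) : ℝ) / count (d + 2) (N + 2)) = cN4 / cN := by
    rw [← hcN_def, ← hcN2_def, ← hcN4_def]
    field_simp
  rw [hφ, ← hcN_def, ← hcN2_def]
  have hZ0 : (0 : ℝ) ≤ Z := Nat.cast_nonneg _
  have hW0 : (0 : ℝ) ≤ W₁ := Nat.cast_nonneg _
  have hA_le : A ≤ cN2 := by rw [ha', hb]; linarith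
  -- `c_{N+2}² = (A + Z)² ≤ c_N Cq + 3 c_{N+2} Z`
  have h1 : cN2 ^ 2 ≤ cN * Cq + 3 * cN2 * Z := by
    have e : cN2 = A + Z := by rw [hb, ha']
    calc cN2 ^ 2 = A ^ 2 + (2 * A + Z) * Z := by rw [e]; ring
      _ ≤ cN * Cq + (2 * cN2 + cN2) * Z := by
          have : (2 * A + Z) * Z ≤ (2 * cN2 + cN2) * Z :=
            mul_le_mul_of_nonneg_right (by linarith) hZ0
          linarith
      _ = cN * Cq + 3 * cN2 * Z := by ring
  -- `(c_{N+2}/c_N)² ≤ Cq/c_N + 3 c_{N+2} Z / c_N²`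
  have h2 : (cN2 / cN) ^ 2 ≤ Cq / cN + 3 * cN2 * Z / cN ^ 2 := by
    have e : Cq / cN + 3 * cN2 * Z / cN ^ 2 = (cN * Cq + 3 * cN2 * Z) / cN ^ 2 := by
      field_simp
    rw [e, div_pow]
    exact div_le_div_of_nonneg_right h1 (by positivity)
  -- `B/c_N ≤ c_{N+4}/c_N`
  have h3 : B / cN ≤ cN4 / cN := div_le_div_of_nonneg_right hc hcN.le
  -- `(Cq - B)/c_N ≤ (K + 10C)/N`
  have h4 : Cq / cN - B / cN ≤ (K + 10 * C) / N := by
    rw [← sub_div, div_le_iff₀ hcN]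
    linarith
  -- `3 c_{N+2} Z / c_N² ≤ 3 C c₂² / N`
  have h5 : 3 * cN2 * Z / cN ^ 2 ≤ 3 * C * c₂ ^ 2 / N := by
    have s1 : 3 * cN2 * (Z : ℝ) ≤ 3 * cN2 * (C * cN2 / N ^ 3) :=
      mul_le_mul_of_nonneg_left hf (by positivity)
    have s2 : 3 * cN2 * (C * cN2 / N ^ 3) / cN ^ 2 = 3 * C * (cN2 / cN) ^ 2 / N ^ 3 := by
      field_simp
    have s3 : (cN2 / cN) ^ 2 ≤ c₂ ^ 2 := by
      refine pow_le_pow_left₀ (by positivity) ?_ 2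
      rw [div_le_iff₀ hcN]; linarith
    have s4 : 3 * C * (cN2 / cN) ^ 2 / N ^ 3 ≤ 3 * C * c₂ ^ 2 / N ^ 3 :=
      div_le_div_of_nonneg_right (mul_le_mul_of_nonneg_left s3 (by positivity)) (by positivity)
    have s5 : 3 * C * c₂ ^ 2 / (N : ℝ) ^ 3 ≤ 3 * C * c₂ ^ 2 / N := by
      refine div_le_div_of_nonneg_left (by positivity) hN0 ?_
      calc (N : ℝ) = N ^ 1 := (pow_one _).symm
        _ ≤ N ^ 3 := pow_le_pow_right₀ hN1 (by norm_num)
    calc 3 * cN2 * Z / cN ^ 2 ≤ 3 * cN2 * (C * cN2 / N ^ 3) / cN ^ 2 :=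
          div_le_div_of_nonneg_right s1 (by positivity)
      _ = 3 * C * (cN2 / cN) ^ 2 / N ^ 3 := s2
      _ ≤ 3 * C * c₂ ^ 2 / N ^ 3 := s4
      _ ≤ 3 * C * c₂ ^ 2 / N := s5
  have h6 : (K + 10 * C + 3 * C * c₂ ^ 2) / (N : ℝ) = (K + 10 * C) / N + 3 * C * c₂ ^ 2 / N := by
    ring
  rw [h6]
  linarith

/-- **Kesten's ratio limit theorem from Kesten's pattern theorem for `(V, Q)`**: if for every
dimension `d + 2 ≥ 2` there are `a > 0` and `C` such that for all `N ≥ 1` at most `C c_N/N³`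
of the `N`-step self-avoiding walks have fewer than `aN` occurrences of `(V, Q)`, then
`c_{N+2}/c_N → μ²` in every dimension `d ≥ 1` (`BDGS2012_tendsto_count_ratio_two`). This is
Madras–Slade's proof of Theorem 7.3.4(a) with Kesten's Pattern Theorem 7.2.3(a) — in the weak
polynomial form that the proof of Theorem 7.3.2 actually uses — as the only remaining input.
[cite: MadrasSlade1993, Theorem 7.3.4(a) (proof)] -/
theorem BDGS2012_tendsto_count_ratio_two_of_patternBound
    (hPT : ∀ d : ℕ, ∃ a C : ℝ, 0 < a ∧ ∀ n : ℕ, 1 ≤ n →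
      ((((saws (d + 2) n).filter fun ω => (vCount n ω : ℝ) < a * n).card : ℝ)) ≤
        C * count (d + 2) n / (n : ℝ) ^ 3) :
    BDGS2012_tendsto_count_ratio_two := by
  refine BDGS2012_tendsto_count_ratio_two_of_thm732 fun d hd => ?_
  obtain ⟨d', rfl⟩ : ∃ d', d = d' + 2 := ⟨d - 2, by omega⟩
  obtain ⟨a, C, ha, h⟩ := hPT d'
  exact thm732_of_patternBound d' ha h

end Theorem732

end KestenPatterns

end Literature.Probability.RandomPlanarGeometry.SAW.Zd
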